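import Summits.HodgeConjecture.HodgeConjecture.Theses.HeckePrymWeil
import Literature.AlgebraicGeometry.Motives.AbelianVarietyProjectiveChart
import Summits.HodgeConjecture.HodgeConjecture.Theorems.WeilTenfoldsSqrtMinus11.Negative.EigenvalueSeparation
import Summits.HodgeConjecture.HodgeConjecture.Theorems.WeilTenfoldsSqrtMinus11.Negative.KillPropagation
import Literature.AlgebraicGeometry.HodgeTheory.ComplexConjugation
import Literature.AlgebraicGeometry.Motives.AbelianVarietyProduct
import Literature.AlgebraicGeometry.Motives.AbelianVarietyProductDimProofs
import Literature.AlgebraicGeometry.Motives.HyperbolicWeilType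
import Literature.AlgebraicGeometry.Motives.WeilDiscriminantRealization
import Literature.AlgebraicGeometry.Motives.WeilDiscriminantProduct
import Literature.AlgebraicGeometry.HodgeTheory.WeilClassesFourfoldsProofs
import Literature.AlgebraicGeometry.HodgeTheory.SemiregularVariationalHodge
import Literature.AlgebraicGeometry.HodgeTheory.KaehlerClass

/-!
# Disproof of `WeilTenfoldsSqrtMinus11` — findings

Crux `stmt-HodgeConjecture-1262` = `Summit.HodgeConjecture.HodgeConjecture.Theses.HeckePrymWeil.WeilTenfoldsSqrtMinus11`
(route `HeckePrymWeil`, rung `(p, g') = (11, 2)`): for every complex abelian variety `A` with `A.dim = 10` and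
every `φ : A ⟶ A` with `φ ≫ φ = -11`, every rational `(5,5)`-class `c ∈ H¹⁰(A(ℂ); ℂ)` lying in
`Eig((𝟙+φ)^*, (1+i√11)¹⁰) ⊔ Eig((𝟙+φ)^*, (1-i√11)¹⁰)` (the complexified Weil plane of `K = ℚ(√-11)`) lies in
`algebraicClasses A.X 5`. Standing adversary: `refuter-cdisprove-stmt-HodgeConjecture-1262-0`. Prose only in
docstrings; every `theorem` without `sorry` is kernel-checked (rc 0); `sorry` marks documented near-misses (§E).

## VERDICT (cycle 3, 2026-08-16, seat `refuter-cdisprove-stmt-HodgeConjecture-1262-g3-0`): STILL NO KILL — TARGETS = the 6 stubs of the PICKED line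

Cycle 3 = re-arm at `rearm.level 2`: line `generic-ppav-secant-descent` PICKED (lead `prover-line-stmt-HodgeConjecture-1262-0`,
skeleton sha 7545e3bc, 6 registered stubs, `stuck_stubs = []`, drefute report `DrefuteGenericPpavSecantDescent.md`:
0 stub-false / 0 misstated / 6 survived — this seat's independent pass CONCURS). New, all kernel-checked (rc 0, 0 sorry
outside §E):
* (F9) §D TARGETS, the six stubs re-stated VERBATIM and placed in the implication web (what a kill of each would mean):
  - S1 `stub_secantSpread` = (anchor EXISTS) ∧ (Weil classes SPREAD from it): `stubSecantSpread_iff`; the spreading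
    block holds for ARBITRARY anchor data under HC (`secantSpreadFrom_of_hodgeConjecture`: `w s` is a rational `(6,6)`
    class on the smooth projective fibre, `IsSmoothProjectiveFamily.isSmoothProjective`), so under HC S1 ⟺ "a split,
    K-compatibly Kähler-polarised, hyperbolic ℚ(√-11)-twelvefold exists" (`stubSecantSpread_iff_exists_anchor_of_hodgeConjecture`);
    refutation shape: given any anchor, `¬S1 → ¬HC`. Cheapest classical anchor: `E⁶ × E⁶` for ANY elliptic curve `E`
    (no CM), `ψ₀ = (0, -11; 1, 0)`, `E₀ = E_X ⊕ 11·E_X̂` (K-compatible: `ψ₀^*E₀ = 11E₀`), type `(6,6)` because `ψ₀`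
    is off-diagonal of square `-11` on `H^{1,0}(X) ⊕ H^{1,0}(X̂)`, hyperbolic since `(-11)⁶ = (11³)²` — its ENDOMORPHISM
    half is now a theorem on every square `X × X` (`exists_offDiagonal_on_square`: `ψ₀ = (0,-11;1,0)`, `e₀ = pr₁`,
    pure preadditive algebra; `exists_twelvefold_offDiagonal_of_sixfold`), its cohomological half (`h₀`, the
    12-frame) needs Künneth for `complexBetti` (F2). CAVEAT for the lead: the ENGINE runs only at an anchor
    where the secant object is semiregular (an open condition on `X ∈ A₆` whose explicit members are unknown); `∃` hides
    that a SPECIFIC sixfold must eventually be named.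
  - S2 `stub_moduliReach`: its conclusion is the rung `HWA(11,6)` RESTRICTED to hyperbolic polarised members
    (`stubModuliReachCore_of_hwa11_six`), hence follows from HC (`…_of_hodgeConjecture`) and from the route's own
    `HodgeWeilLadder ∧ WeilDescending` (`hwa11_six_of_ladder`: rung `(11,3)` = `HWA(11,10)`, four descents); NB dimension
    12 is NOT a Hecke–Prym rung (`6 ∉ 5ℕ`). A refutation of S2's conclusion refutes `HWA(11,6)`, never the crux directly.
  - S6 `stub_descent` is WEAKER THAN THE CRUX: `stubDescentCore_of_crux` (drop the partner); `¬S6 → ¬crux → ¬HC`.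
    Its projector step is sound arithmetic: the mixed product eigenvalues `μ₁ = λ₊¹⁰λ₋² = -2082816 - 645120·i√11`,
    `μ₂ = μ̄₁` have `μ₁ + μ₂ = -4165632`, `μ₁μ₂ = 12¹²` (`mixedPair_sum_eq/_mul_eq`: `q(X) = X² + 4165632X + 12¹² ∈ ℤ[X]`
    as the docstring needs) and `q(λ±¹²) ≠ 0` (`projector_ne_zero_at_plus/_minus`).
  - S3 `stub_aimingArithmetic` (Landherr/Meyer, provable now): TWO `_false_without_` THEOREMS (§I), valid in every model
    `K` of ℚ(√-11): without the signature block it FAILS at `n = 1`, `V = K²`, `E = E_{(1,1)}` definite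
    (`aiming_false_without_signature`); without `0 < r₁r₂` it FAILS at `E = E_{(1,-1)}`, `(r₁,r₂) = (1,-1)`
    (`aiming_false_without_sign`, with the signature block WITNESSED: `signature_one_one`) — both by the kernel vector of
    one coordinate functional on a `K`-plane and `H(x,x) = Σ cᵢ Nm(xᵢ)` (`diagWeilForm_self_alpha`). Any proof must
    use both hypotheses; the equal-weight shortcut of drefute's `AimingZero` (n = 0) does not generalise.
  - S4 `stub_hyperbolicPartner` (construction; F2-unconstructible) and S5 `stub_hodgeTypeExterior` (Künneth, theorem):
    no typed handle; S4's Weil-type witness `∃ c ≠ 0` is load-bearing on paper (`E¹⁰`, §B), S5 is shared verbatim with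
    crux 1260.
* (F10) BOOKKEEPING of the bet re-derived a 4th time, independently (exact arithmetic, `compute/bookkeeping.py` in the
  cdisprove folder, attached as evidence) AND NOW IN THE KERNEL (§J, `decide +kernel`, axioms standard:
  `secantConfiguration_n6/_n5`, `config6_seven` + `target2_seven` + `no_integral_m7`, `rankOne_d11_a1`,
  `rankOne_d44_a_neg18_n5`): in `K[y]/(y^{n+1})`, `y = 1 - e^{-Θ}`, `[O_{codim-k theta-CI}] = yᵏ`:
  rank 2, `d = 11`, twist 1: `(m₂,…,m₆) = (12, 4, 57, 36, 462)` at `n = 6` (extending `n = 5`), `m₇ = 2754/7`,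
  `m₈ = 110505/28` (non-integral: the window `n ≤ 6` is exact); rank 1, `d = 11`: `m₄ ∈ ½ + ℤ` for `a = ±1, 3, 5`,
  `m₂ ∉ ℤ` for `a = 2, 4`; `d = 44`, `n = 5`, `a = -18`: `(184, 2392, 34546, 534428)` — every digit of the card
  confirmed. NB the convention: "points" are `yⁿ`-units, i.e. `n!` points each (`462·720` points at `n = 6`).
* (F1'') Literature re-check 2026-08-16 (zbMATH live; searchd rc 75, arXiv/OpenAlex/S2 HTTP 429): no new item on Weil
  classes since cycle 2 (Markman 2502.03415 / 2509.23079 / 2509.23403, Floccari–Fu JMPA 2026 = fourfolds disc 1 via OG6,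
  Perry 2604.00511); nothing negative in print.
* Census of attacks this cycle: stub read-back ×6 (verbatim restatement, kernel); HC/crux/ladder certificates for S1/S2/S6
  (theorems); S3 hypothesis deletion ×2 (both FALSE, theorems); S6 projector integrality (theorems); bookkeeping (script);
  literature (zbMATH). The crux resists because every typed handle reduces to `¬HC` on an abelian variety (F1), and the
  line's only open content (semiregularity of a rank-2 theta-CI secant object at `n = 6`) is not expressible in the tree.

## VERDICT (cycle 2, 2026-08-16, seat `refuter-cdisprove-stmt-HodgeConjecture-1262-g2-0`): STILL NO KILL

Cycle 2 = re-arm at `rearm.level 1` (ideation panel done: 6 cards, 3 triages; no line picked, no skeleton,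
`targets = stuck_stubs = []`). New this cycle (all kernel-checked unless marked; three Negative/ files proposed,
all four ACCEPTED: p76314 `AnchorTyping`, p76316 `KillPropagation`, p76415 `WeilPlaneReality`, p76722 `WeilPlaneKernel`):
* (F1') LITERATURE SWEEP now run (searchd/galaxy were down in cycle 1; zbMATH + arXiv answered, OpenAlex 429,
  local searchd still rc 75): nothing negative exists in print on `ℚ(√-11)` (or any) Weil classes; frontier =
  all abelian varieties of dimension `≤ 5` and Weil sixfolds of discriminant `-1` for every `K` (Markman
  arXiv:2502.03415, as cited by van Geemen–Rapagnetta arXiv:2607.18341 p. 1, July 2026; Floccari–Fu; Markman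
  2509.23079/23403 add CM fields, "semiregularity not addressed"); Milne arXiv:2010.08857 (READ pp. 4–7):
  every Hodge class on an abelian variety is ACCESSIBLE (Deligne 1982) and a sum of pull-backs of SPLIT Weil
  classes (André 1992 = Thm 1); HC for abelian varieties follows from the variational Hodge conjecture for
  abelian schemes over complete curves in locally symmetric varieties (Thm 3, Rem. 2–3) and from standard
  conjecture B (André 1996). So a counterexample to this crux would be a non-algebraic absolute-Hodge,
  motivated, accessible class and would refute VHC over a complete curve — on top of (F1). No refutation
  lead; `ledger negatives --problem HodgeConjecture` still lists 2 entries, unrelated.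
* (F6) KILL PROPAGATION (§A+; LANDED `Negative/KillPropagation`, p76316): `¬crux → ¬HodgeWeilLadder`;
  `WeilDescending → ¬crux → ¬HWA(11,m)` for every `m ≥ 5` — a kill here kills every higher `ℚ(√-11)` rung,
  in particular the twelvefold shadow `HWA(11,6)` of card `weil-projector-graph-seeds` (its
  `crux_of_twelvefolds` contraposed) and all Hecke–Prym rungs `(11,g')`; conversely crux + Descending give
  dims `2,4,6,8`, and dims `≤ 4` are theorems — no lower rung is a handle either.
* (F7) REAL STRUCTURE of the typed plane at `p = 11` (§G; LANDED `Negative/WeilPlaneReality`, p76415):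
  conjugation swaps `Eig₊`/`Eig₋`; the `+`-only / `-`-only variants of the crux are PROVABLE OUTRIGHT
  (refuted-as-vacuous strengthenings of the typing); any counterexample class has two non-zero, non-rational,
  conjugate components (`weilComponents_conj/_ne_zero`, `weilComponent_rational_imp_zero`); 2×2 inversion.
  (F7') THE PLANE IS CUT OUT OVER `ℤ` (§G; LANDED `Negative/WeilPlaneKernel`, p76722): `Eig₊ ⊔ Eig₋ =
  ker (T² - 486400·T + 12¹⁰)`, `T = (𝟙+φ)^*` (`λ = (1+i√11)¹⁰ = 243200 + 15872·i√11`, trace `486400`, norm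
  `12¹⁰ = 61917364224`; generic `eigenspace_sup_eigenspace_eq_ker`): one integral linear condition, so the
  plane is `W ⊗ ℂ` for a ℚ-subspace `W` as soon as `complexBetti` has a ℚ-form — the single missing input of
  the near-miss `withoutRat_iff` — and a witness must solve `T²c - 486400·Tc + 12¹⁰c = 0`.
* (F8) TYPED-STUB AUDIT of the six cards' first lemmas (§H; LANDED `Negative/AnchorTyping`, p76314): the
  adversary tried to make the cyclotomic anchor stubs (`CyclotomicNormAnchor`, `NormIdentity`,
  `LAnchorWeilLefschetz`, `CyclotomicTenfoldCase`) vacuous or junk-satisfiable. (i) Eigenvalue collisions on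
  `∧²H¹`: NONE — `rootOfUnity_one_add_mul_collision_free`: for odd `n`, `u,v,w ∈ μ_n`,
  `(1+v)(1+w) = (1+u)² ⇒ v = w = u` (so `Eig((𝟙+ψ)^*|H², (1+u)²) = ∧²U_u` exactly; oddness needed,
  `collision_at_even`); `one_add_sq_ne_four`, `two_mul_one_add_ne_one_add_sq`: the `ψ^* = 1` block never
  interferes. (ii) JUNK MODEL `m = 1`: `SignatureOneOne` only bounds eigenspaces from above, so it ALLOWS
  `U_u = 0`: `A = B⁵ × A''`, `A''` a CM fivefold by `ℚ(ζ₁₁)`, `ψ = 𝟙 × ζ` satisfies `pow11 ψ = 𝟙`, `ψ ≠ 𝟙`,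
  `SignatureOneOne` (all `(1+u)²`-eigenspaces on `H²` vanish: `∧²` of a line is `0`, and (i)); there
  `gaussSum ψ = 0 × √-11`, so `φ ≫ φ ≠ -11`: it is `hφ` — equivalently the norm condition `Σ_{k<11} ψᵏ = 0`,
  by the ring identity `gaussSum11_sq : z¹¹ = 1 → g(z)² = -11 + Σ zᵏ` (ANY ring) — that removes the junk
  model, NOT the signature hypothesis (card 1's docstring "SignatureOneOne forces no eigenvalue 1" is false
  but harmless). `NormIdentity` (no `hφ`) survives the junk model vacuously (`weilPlus = weilMinus = 0`
  there: `|λ| = 12^{(b+c)/2}` forces `b = c = 5`, and `((1+i√11)/(1-i√11))⁵ ≠ 1`). (iii) `GaussPeriodDesign r`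
  (card 1's purity stub) is TRUE for large `r` and carries no index/Ext information (triage concurs): with all
  `n_t = 0` every `k ≥ 1` condition is void (`0ᵏ = 0`), and for `λ_t ∈ K` the 1020 set-conditions collapse to
  the 32 "bad bidegrees" `(i,j) = (|S∩□|, |S∩⊠|) ∉ {(0,0),(5,0),(0,5),(5,5)}`, i.e. 32 rational-linear
  conditions on the weights, while `λ⁵` is an independent monomial — so `r ≤ 33` generic points of `K`
  suffice (paper); from below `not_gaussPeriodDesign_one` AND `not_gaussPeriodDesign_two` are KERNEL-CHECKED
  here (§H: `σ_a` is injective, `embed_eq_zero_iff`, via `minpoly = Φ₁₁` of degree 10; then the singleton /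
  pair bookkeeping) — a purity design needs `r ≥ 3` terms.
  (iv) `QMOrbitDegreeBound` (card 2, failed 2/3 at triage): no junk instance (empty `D` gives the zero
  subspace; `coheight ≥ 5` forbids the zero section) — mathematically false by the triagers' Noether–Lefschetz
  no-go, not Lean-refutable (F2). (v) `OffDiagonalAnchor`, `WeilTwelvefoldsSqrtMinus11Hyp`,
  `CyclotomicTenfoldCase`, `LAnchorWeilLefschetz`: literal special cases / HC-consequences (`*_of_crux`
  kernel-checked by their authors) — irrefutable by (F1).
* Census of attacks this cycle: literature negatives (none); typed-stub junk models ×6 (one junk model found,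
  excluded by `hφ`); `H²`-collision attempt (refuted by theorem); one-eigenline strengthening (vacuous,
  theorem); componentwise strengthening (false unless `c = 0`, theorem); kill-propagation map (theorem); GPD
  small-`r` (`r = 1, 2` theorems). The crux resists because every handle reduces to `¬HC` on an
  abelian variety (F1), now also `¬VHC` over a complete curve (F1').

## VERDICT (cycle 1, 2026-08-16): NO KILL — and the reason is itself a theorem here

* (F1) `not_hodgeConjecture_of_not` : `¬ crux → ¬ HodgeConjecture` (§A, sorry-free, axioms {propext, choice,
  Quot.sound}). The tree PROVES `AbelianVariety.isSmoothProjective_holds`, so the summit applied to `A.X` at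
  `p = 5` yields the crux without using `φ ≫ φ = -11` or the Weil-plane hypothesis. Hence ANY refutation of this
  crux is a counterexample to the Hodge conjecture on an abelian variety; by André 1996 (Thm 0.6.2, barrier
  `Literature.Barriers.HodgeConjecture.MotivatedClassesAbelianVarieties`:
  `not_lefschetzStandardConjecture_of_counterexample`) it would refute Grothendieck's standard conjecture `B`, and
  by Deligne 1982 the class would be absolute Hodge. Nothing of the kind is known or conjectured in print: Weil
  (1977) proposed `W_K` as TEST classes and every decided case came out algebraic (Schoen 1988 / van Geemen 1994
  for `ℚ(√-3)`, `ℚ(i)`; Koike 2004; Markman 2025: all fourfolds, sixfolds of discriminant `-1`); for `ℚ(√-11)` in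
  dimension `10` NOTHING is decided in any component (route text; `ledger negatives` HodgeConjecture: 2 entries,
  neither on Weil classes).
* (F2) No object-level attack is expressible: the tree constructs no `AbelianVariety ℂ` of positive dimension with
  complex multiplication (only the zero abelian variety, `dim 0 ≠ 10`, and Weierstrass-curve models without extra
  endomorphisms), no Künneth for `complexBetti`, no `H^*(A) = ∧^*H¹`. So none of the `Without…` falsity witnesses of
  §B can be kernel-checked today; they are recorded with the exact witness in the docstring.

## INDEX
* §A  summit-hardness: `crux_iff` (read-back), `not_iff` (shape of a refutation), `not_hodgeConjecture_of_not`,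
      `not_hodgeConjecture_of_counterexample` (φ and Weil plane forgotten), `not_hodgeWeilLadder_of_not`
      (¬crux ⇒ ¬target 1259, by instantiation `(p,g,n) = (11,2,5)`).
* §B  LOAD-BEARING ANALYSIS, one `def Without<H>` per hypothesis:
      `WithoutDim`   — equivalent to the crux (a `HodgeModel 10 A.X` forces `dim A = 10`); `not_withoutDim_of_not`.
      `WithoutPhi`   — still a consequence of HC: `not_hodgeConjecture_of_not_withoutPhi` (checked). No leverage.
      `WithoutRat`   — equivalent to the crux (algebraicClasses is a ℂ-subspace; W_K ⊗ ℂ ∩ H^{5,5} is spanned by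
                       rational classes). `withoutRat_iff` is a near-miss (§E): needs the ℚ-form of the Weil plane.
      `WithoutHodgeType` — FALSE: `A = E¹⁰`, `E = ℂ/ℤ[(1+√-11)/2]` (`h(-11) = 1`, `√-11 ∈ End E`), `φ = diag(√-11)`:
                       signature `(10,0)`, `W_K ⊗ ℂ = H^{10,0} ⊕ H^{0,10}`, every nonzero rational Weil class has a
                       nonzero `(0,10)`-component, hence is not in `algebraicClasses ⊆ H^{5,5}`. THE load-bearing
                       hypothesis: any proof must use `hhodge`. `withoutHodgeType_false` is a near-miss (§E, F2).
      `WithoutWeilPlane` — HC in degree 10 for tenfolds with `√-11 ∈ End A`: OPEN, strictly stronger (exceptional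
                       classes of special members), still implied by HC: `not_hodgeConjecture_of_not_withoutWeilPlane`.
* §C  TYPING / TIGHTNESS (kernel-checked arithmetic): `weilXY`, `one_add_pow_eq`, `one_sub_pow_eq_one_add_pow_iff`,
      `weilXY_snd_ne_zero` (descent), `weil_mixed_ne_plus/minus`, `weil_plus_pow_ne_minus_pow` for ALL primes
      `p ≠ 3` and all exponents; instances `weil11_*` (this crux: the 9 mixed eigenvalues `(1+i√11)ᵃ(1-i√11)ᵇ`,
      `ab ≠ 0`, `a+b = 10`, and the two pure ones are pairwise distinct ⇒ `Eig₊ ⊔ Eig₋ = ∧¹⁰V₊ ⊕ ∧¹⁰V₋` exactly,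
      `Eig₊ ⊓ Eig₋ = 0`); `weil3_cube_collision`, `weil3_mixed_eq_plus`: at `p = 3`, `2n = 6` the typing FAILS
      (mixed `(3,3)` eigenvalue = pure one = 64) — the ladder's exclusion of `p = 3` is load-bearing for MEANING;
      `not_separation_all_p` : the natural strengthening "separation for every `p ≥ 2`" is false (witness `(3,3)`).
* §A+ (cycle 2) KILL PROPAGATION: `descend_logic`, `not_hwa11_of_not` (`m ≥ 5`), `not_rung11_of_not` (`g' ≥ 2`)
      — LANDED as `Negative/KillPropagation` (p76316); inline copies here until the farm has built it.
* §D  (cycle 3) TARGETS = the six registered stubs of line `generic-ppav-secant-descent` (skeleton 7545e3bc), restated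
      VERBATIM: `SecantAnchor`, `SecantSpreadFrom`, `StubSecantSpread`, `stubSecantSpread_iff`,
      `secantSpreadFrom_of_hodgeConjecture`, `stubSecantSpread_iff_exists_anchor_of_hodgeConjecture`,
      `not_hodgeConjecture_of_anchor_of_not_stubSecantSpread`, `exists_anchor_of_stubSecantSpread`,
      `exists_offDiagonal_on_square`, `exists_twelvefold_offDiagonal_of_sixfold` (S1: the endomorphism half
      of the anchor is constructible on any `X × X`; only the cohomological half is F2-blocked);
      `StubModuliReachCore`, `StubModuliReach`, `HWA11`, `stubModuliReachCore_of_hwa11_six/_of_hodgeConjecture`,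
      `hwa11_six_of_ladder`, `not_hwa11_six_of_not_stubModuliReachCore` (S2); `StubDescentCore`,
      `stubDescentCore_of_crux`, `not_crux_of_not_stubDescentCore`, `mixed_ten_two_eq`, `mixed_two_ten_eq`,
      `mixedPair_sum_eq`, `mixedPair_mul_eq`, `projector_ne_zero_at_plus/_minus` (S6). No stuck stubs yet.
* §I  (cycle 3) S3 TIGHTNESS: `nm`, `diagWeilForm_self_alpha` (`H(x,x) = Σ cᵢ Nm xᵢ`), `signature_one_one`,
      `aiming_false_without_signature`, `aiming_false_without_sign`.
* §J  (cycle 3) BOOKKEEPING OF THE BET in the kernel: `kmulD`, `cpowD` (`(1-y)^{-√-d}`), `oneSubCoeff`, `strata`,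
      `conv`, `target2`, `target1`, `config6`, `config5`; `secantConfiguration_n6`, `secantConfiguration_n5`,
      `config6_seven`, `target2_seven`, `strata_seven_shift`, `no_integral_m7` (window `n ≤ 6`), `rankOne_d11_a1`
      (parity obstruction, `m₄ = 21/2`), `rankOne_d44_a_neg18_n5` (`(184, 2392, 34546, 534428)` integral).
* §E  Near-misses (`sorry`, obstruction in docstring): `withoutHodgeType_false`, `withoutRat_iff`,
      `gaussPeriodDesign_large` (TRUE; paper witness scheme).
* §G  (cycle 2) REAL STRUCTURE at `p = 11`: `conjClass_mem_eigenspace_map`, `eq_zero_of_isRationalClass_of_mem_eigenspace`,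
      `conj_one_add_I_sqrt11_pow`, `rational_mem_plusEigenspace_eq_zero`, `onlyPlusVariant_holds`,
      `onlyMinusVariant_holds` (refuted-as-vacuous strengthenings), `weilComponents_conj`,
      `weilComponent_rational_imp_zero`, `weilComponents_ne_zero`, `weilComponents_mem_span_pair` — LANDED
      `Negative/WeilPlaneReality` (p76415); `eigenspace_sup_eigenspace_eq_ker`, `weilEigenvalue_ten_eq`,
      `weilEigenvalues_ten_add/_mul`, `weilPlane_eq_ker_quadratic` — LANDED `Negative/WeilPlaneKernel`
      (p76722); inline copies here (switch to `export` once the farm has built the four modules).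
* §H  (cycle 2) ANCHOR-STUB TYPING: `rootOfUnity_one_add_mul_collision_free`, `collision_at_even`,
      `one_add_sq_ne_four`, `two_mul_one_add_ne_one_add_sq`, `gaussSum11_sq`, `gaussSum11_sq_eq_neg_eleven_iff`
      — LANDED as `Negative/AnchorTyping` (p76314); plus (work-file only) the verbatim copies `zeta11`, `embed`,
      `squares11`, `GaussPeriodDesign` of card 1's sketch with `embed_eq_zero_iff`, `not_gaussPeriodDesign_one`,
      `not_gaussPeriodDesign_two` (a purity design needs `r ≥ 3`).

## JUNK-MODEL AUDIT of the carriers (all REAL definitions; concurs with route reviews 1–7 on the item)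
`AbelianVariety ℂ` = proper geometrically-integral group scheme over `Spec ℂ`, `Hom` group = pointwise law, so
`𝟙 + φ` and `11 • 𝟙` are the genuine endomorphisms; `complexBetti` = singular cohomology of `A(ℂ)` with the STRONG
topology (`AlgPoints.instTopologicalSpace`); `IsRationalClass` = ℚ-valued cocycle; `algebraicClasses A.X 5 = N⁵H¹⁰`
through Zariski-closed `Z` with pointwise `5 ≤ coheight` in Mathlib's specialization preorder on `Scheme`
(`x ≤ y ↔ y ⤳ x`: coheight = codimension ✓); `IsOfHodgeType` = ∃ `HodgeModel 10 A.X` — exotic models cannot enlarge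
`H^{5,5}`: `IsAnalytification` (homeomorphism + `finrank = 10` + regular functions holomorphic) pins the complex
structure by Osgood, and a natural automorphism of `H¹⁰(−; ℂ)` on manifolds charted on the model is a scalar on
`A(ℂ)` (linear real sub-tori have open tubular neighbourhoods, decomposable classes span `∧¹⁰Λ`), scalars fix
`hodgePQ.map deRham`. No `[Fintype]`/universe restriction; `2 * 5` vs `10` defeq. Nothing to exploit.

## NATURAL STRENGTHENINGS that are FALSE (documentation; not checkable, F2)
(S1) support in codimension 6 (`c ∈ supportedClasses A.X 10 6`): false for `c ≠ 0` (`N⁶H¹⁰ ⊆ F⁶`, a `(5,5)`-class is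
not) — the index `5` is tight. (S2) `W_K ⊆ D⁵ ⊗ ℂ` (divisor ring): false for the general member of each
25-dimensional Weil component (Weil 1977 = barrier `Weil1977_exceptionalHodgeClasses`, van Geemen Thm 4.11) — this is
WHY the crux is hard: a line must produce correspondence / sheaf classes outside `D⁵`. (S3) dropping `7 ≤ p` in the
ladder: at `p = 3` the typed statement no longer speaks about the Weil plane (§C).

## MECHANISM BOOKKEEPING re-derived (riders 1410–1412 informal; no misstatement found)
`|F₅₅| = 55`; étale `F₅₅`-cover of genus 2: `2g(C̃) - 2 = 110`, `g(C̃) = 56` ✓; `C = C̃/μ₅` étale, `g(C) = 12` ✓;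
`dim P = 12 - 2 = 10` ✓; irreps of `F₅₅`: 5 linear + 2 of degree 5 (`5 + 50 = 55`), `ℚ(χ) = ℚ(√-11)` (Gauss periods of
length 5) ✓; `μ\F/μ` has 3 double cosets ⇒ `ℚ[μ\F/μ] ≅ End_{ℚF} ℚ[F/μ] ≅ ℚ × ℚ(√-11)`, Schur index 1 ✓; Chevalley–Weil:
mult of `χ` in `H¹(C̃)` is `2·5 = 10 = dim M_χ`, half holomorphic ⇒ `(5,5)` ✓; `dim Sym¹⁰(ℂ⁵) = C(14,4) = 1001` ✓,
5 pure + 996 mixed lines ✓; component dimension `n² = 25 ⊋ 3 = 3g'-3` ✓. NEW remark on the planner's worry "C' is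
hyperelliptic": `Aut(F₅₅) = ℤ/11 ⋊ (ℤ/11)^×` acts TRIVIALLY on `F₅₅^{ab} = μ₅` (`a ↦ aⁱ`, `b ↦ aʲ b`), while the
hyperelliptic involution `ι` acts by `-1` on `H₁(C')`, hence on the `μ₅`-part of every surjection `π₁(C') ↠ F₅₅`;
since `-1 ≠ 1` on `ℤ/5`, `ι_*(ker ρ) ≠ ker ρ` for EVERY `F₅₅`-cover: `ι` never lifts to `C̃`, so it contributes no
extra automorphism to `C̃`, `C` or `P` (kill criterion K1 is not triggered by hyperellipticity alone; same for `F₂₁`).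

## SCOPE REMARKS (what the typed crux does and does not say)
* `φ ≫ φ = -11` means `√-11 ∈ End A`, i.e. `End A ∩ K ⊇ ℤ[√-11]` (conductor `f ∣ 2` in `O_K = ℤ[(1+√-11)/2]`); a
  Weil-type `A` whose order has conductor `f ∤ 2` is outside the literal scope but isogenous to one inside —
  harmless for the sector logic (`SummitOffWeilSector` is typed identically), and a prover never needs such `A`.
* No hidden polarization restriction: for any polarization `E`, `p·E + φ^*E` is a `K`-hermitian polarization
  (`E'(φx, φy) = p·E'(x, y)`), so "all `(A, φ)` of signature `(5,5)`" = all polarized Weil triples, i.e. EVERY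
  discriminant class `det H ∈ ℚ^×/Nm(K^×)` (infinitely many deformation components, van Geemen 5.2 (3)).
* Consequently the crux is NOT matched to the single mechanism NS(11,2)+T: the 3-dimensional Hecke–Prym family
  meets finitely many of the 25-dimensional components; the remaining components of dimension 10 are reached in the
  route only through rung `(11,3)` (dimension 20) + `WeilDescending`, or by a transport ACROSS components. Triagers
  should not grade a `(11,2)`-only line as closing this item (planner's deliberate sector design, recorded here).

## OPEN ADVERSARIAL QUESTIONS (next cycles; none is a refutation lead — F1 forbids one)
* Generic Mumford–Tate group of the Hecke–Prym family on `M_χ ⊕ M_χ̄`: is the 3-dim family Hodge-generic in its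
  component (connected monodromy Zariski-dense in `SU(H)`), or does it lie in a proper special subvariety (extra
  generic Hodge classes; possible anchor degeneration K1)? Computable in principle: `Mod(Σ₂)`-orbits on
  `Epi(π₁Σ₂, F₅₅)/Aut` and the induced action on the `χ`-isotypic part of `H¹(C̃)` by Fox calculus — a `kit gap`
  job once a picked line leans on genericity. (The hyperelliptic involution contributes nothing: it never lifts.)
* `det H` of the Prym polarisation `E|_P` (rider 1411 (b)): which components does the family meet?
* Literature sweep DONE in cycle 2 (F1'): nothing negative in print; frontier = dim ≤ 5 (all AV) and disc `-1`
  sixfolds (all `K`). Local full-text index (searchd) was still down — only remote zbMATH/arXiv were searched.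
* For the lead, once a line is picked: every anchor line's FIRST provable stub needs `H•(A(ℂ)) = ∧•H¹` for
  `complexBetti` and the named fact `lefschetzOneOne_rational`; the adversary's typing lemmas (§C, §G, §H) are
  the only parts of those stubs checkable today.

## FOR THE PROVERS (learnings)
* `hdim` is free (implied by `hhodge`); `hrat` may be discarded only after the ℚ-form of `Eig₊ ⊔ Eig₋` is in hand;
  `hhodge` may NOT be discarded (§B witness). `hφ` + `weil11_*` give `Eig₊ ⊓ Eig₋ = 0` and `λ ≠ λ̄` for
  WeilDescending's 2×2 inversion; the general `weil_mixed_ne_*` serve every rung and the target (all `p ≠ 3`, all `n`).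
* The §C lemmas and the summit-hardness theorems are LANDED (p73707, accepted 2026-08-16):
  `import Summits.HodgeConjecture.HodgeConjecture.Theorems.WeilTenfoldsSqrtMinus11.Negative.EigenvalueSeparation`
  (namespace `…Theorems.WeilTenfoldsSqrtMinus11.Negative`); this file re-exports them.

* Cycle 2 toolkit (import once built): `…Negative.AnchorTyping` (`rootOfUnity_one_add_mul_collision_free`,
  `gaussSum11_sq[_eq_neg_eleven_iff]`), `…Negative.KillPropagation` (`not_hwa11_of_not`, `rung11_of_hodgeWeilLadder`),
  `…Negative.WeilPlaneReality` (p76415; `weilComponents_conj`, `weilComponents_mem_span_pair`, `onlyPlusVariant_holds`),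
  `…Negative.WeilPlaneKernel` (p76722; `weilPlane_eq_ker_quadratic`: membership in the plane = one integral linear equation).
  A stub typed on ONE eigenline, or asking a Weil component to be rational, is vacuous/false by §G — type stubs on
  the `⊔` and keep both components.

## FOR THE LEAD (cycle 3, line generic-ppav-secant-descent)
* S3: both the signature block and `0 < r₁r₂` are USED by any proof (§I); `H(x,x)` of `diagWeilForm c` on `Kⁿ` is
  `Σ cᵢ Nm(xᵢ)` (`diagWeilForm_self_alpha`, reusable for the positivity bookkeeping of the real proof).
* S6: the projector `q(T)`, `q(X) = X² + 4165632·X + 8916100448256`, has integer coefficients and `q(λ±¹²) ≠ 0` (§D) —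
  import-free arithmetic ready to paste; S6 is implied by the crux, so prove it LAST if at all costly.
* ANCHOR RECIPE (checked on paper this cycle, endomorphism half kernel-checked): `A₀ = X × X̂`, `X` ANY principally
  polarised sixfold, `ψ₀ = (0, -11φ_Θ⁻¹; φ_Θ, 0)`, `E₀ = E_X ⊕ 11·E_X̂` (then `ψ₀^*E₀ = 11E₀`, so `h₀ = cl(E₀)` is rational,
  `N¹`, ample/Kähler, `Q_{h₀}` non-degenerate); `H(u,u) = E₀(u, ψ₀u) = -22·E_X(v, φ_Θ⁻¹w)` for `u = (v, w)`; for ANY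
  `E_X`-Lagrangian `M ⊂ H₁(X, ℚ)` the subspace `W = M ⊕ φ_Θ(M)` is `ψ₀`-stable (`ψ₀(m,0) = (0,φm)`, `ψ₀(0,φm) = (-11m,0)`)
  and `E₀`-Lagrangian — so `(A₀, ψ₀, h₀)` IS hyperbolic (Witt index 6), for every `X`, with the 12-frame of
  `IsHyperbolicWeilType` = `Ann(W)` = "a Lagrangian half-basis of `H¹(X, ℚ)` in each factor". The same computation in
  half-dimension `n` gives Witt index `n` for every `n` (odd `n`: the hyperbolic class is `det ≡ (-1)ⁿ`, i.e. the
  card's "(−d)ⁿ law"). What the ENGINE needs on top is genericity of `X` (semiregularity), which the typing cannot see.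
* S2 = `HWA(11,6)` on hyperbolic members: any proof of S2 from S1 is a proof of a twelvefold statement the route otherwise
  reaches only via rung `(11,3)`; S1's `∃` must eventually name a SPECIFIC anchor sixfold at which the secant object is
  semiregular (open condition, no explicit member known) — budget for it.

## §F ARITHMETIC OF THE FILED IDEAS re-derived by the adversary (cycle 1 addendum; no grading — triage's job)
* `balanced-undecic-pencil`, falsifier (0): squares mod 11 = {1,3,4,5,9} (sum 22), non-squares {2,6,7,8,10}
  (sum 33), so a branch point contributes 2 resp. 3 to `Σ_{k∈□} dim H^{1,0}_{ζᵏ}` and signature (5,5) ⟺ the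
  4-point pattern is BALANCED ✓; there are 25 balanced multisets, 10 of them unpaired, forming exactly ONE orbit
  under unit scaling `m ↦ u·m` (it contains (3,4,2,2) and (4,9,10,10)) ✓; signature table over k = 1,3,4,5,9 for
  (3,4,2,2): (0,2),(1,1),(1,1),(2,0),(1,1), sum 5 ✓; genus (11−1)(4−2)/2 = 10 ✓; for p = 7 all 6 balanced patterns
  are paired ✓ (enumeration script in the cdisprove folder, `patterns.py`). No slip found.
* `odd-norm-cm-enlargement`: the anchor statement keeps `hhodge`/`hrat` (consistent with §B); its first lemma is
  a SPECIAL CASE of the crux (`lAnchorWeilLefschetz_of_crux` in the ideator's sketch), hence inherits F1: neither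
  it nor `C⁺(δ)` can be refuted short of ¬HC. QM type-II anchors: `D_u = (−11, u)_F` with `u ∈ ℚ_{>0}` is split at
  every real place (u > 0) ✓ totally indefinite, contains `L = F(√-11)` ✓, and type (1,1) at each `τ` is automatic
  for QM (an element `j` with `jℓ = ℓ̄j` swaps `V_τ`, `V_τ̄` and preserves Hodge types) ✓ — consistent with the card.
-/

noncomputable section

set_option linter.dupNamespace false

namespace Summit.HodgeConjecture.HodgeConjecture.Cruxes.WeilTenfoldsSqrtMinus11.Disproof

open CategoryTheory Literature.AlgebraicGeometry Literature.AlgebraicGeometry.Motives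
  Literature.AlgebraicGeometry.HodgeTheory

/-! ## §A Read-back and summit-hardness -/

/-- The `(𝟙 + φ)^*`-Weil plane of the crux, verbatim: `Eig((𝟙+φ)^*, (1+i√11)¹⁰) ⊔ Eig((𝟙+φ)^*, (1-i√11)¹⁰)`
inside `H¹⁰(A(ℂ); ℂ)`. [folklore] -/
def weilPlane (A : AbelianVariety ℂ) (φ : A ⟶ A) : Submodule ℂ (complexBetti A.X 10) :=
  Module.End.eigenspace (complexBetti.map (𝟙 A + φ).hom.hom.hom 10).hom
      ((1 + Complex.I * (Real.sqrt (11 : ℝ) : ℂ)) ^ 10) ⊔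
    Module.End.eigenspace (complexBetti.map (𝟙 A + φ).hom.hom.hom 10).hom
      ((1 - Complex.I * (Real.sqrt (11 : ℝ) : ℂ)) ^ 10)

/-- Read-back: the crux, hypothesis by hypothesis (`hdim`, `hφ`, `hrat`, `hhodge`, `hweil`). [folklore] -/
theorem crux_iff :
    Summit.HodgeConjecture.HodgeConjecture.Theses.HeckePrymWeil.WeilTenfoldsSqrtMinus11 ↔
      ∀ (A : AbelianVariety ℂ) (φ : A ⟶ A), A.dim = 10 → φ ≫ φ = -((11 : ℤ) • 𝟙 A) →
        ∀ c : complexBetti A.X 10, IsRationalClass c → IsOfHodgeType 10 A.X 10 5 5 c →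
          c ∈ weilPlane A φ → c ∈ algebraicClasses A.X 5 :=
  Iff.rfl

/-- Shape of a refutation: a tenfold, `φ` with `φ ≫ φ = -11`, and a rational `(5,5)` Weil class outside
`algebraicClasses A.X 5`. [folklore] -/
theorem not_iff :
    ¬ Summit.HodgeConjecture.HodgeConjecture.Theses.HeckePrymWeil.WeilTenfoldsSqrtMinus11 ↔
      ∃ (A : AbelianVariety ℂ) (φ : A ⟶ A) (c : complexBetti A.X 10), A.dim = 10 ∧
        φ ≫ φ = -((11 : ℤ) • 𝟙 A) ∧ IsRationalClass c ∧ IsOfHodgeType 10 A.X 10 5 5 c ∧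
        c ∈ weilPlane A φ ∧ c ∉ algebraicClasses A.X 5 := by
  rw [crux_iff]
  push Not
  constructor
  · rintro ⟨A, φ, hdim, hφ, c, hrat, hhodge, hweil, hc⟩
    exact ⟨A, φ, c, hdim, hφ, hrat, hhodge, hweil, hc⟩
  · rintro ⟨A, φ, c, hdim, hφ, hrat, hhodge, hweil, hc⟩
    exact ⟨A, φ, hdim, hφ, c, hrat, hhodge, hweil, hc⟩

/-- **(F1) Summit-hardness.** A refutation of the crux refutes the summit: `A.X` is smooth projective of
dimension `A.dim = 10` (`AbelianVariety.isSmoothProjective_holds`, PROVED in the tree), and the summit at `p = 5`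
gives the conclusion for every rational `(5,5)`-class; `hφ`, `hweil` unused.
[cite: Andre1996Motifs, Thm. 0.6.2 and §6.3 Remarque 2] -/
theorem not_hodgeConjecture_of_not
    (h : ¬ Summit.HodgeConjecture.HodgeConjecture.Theses.HeckePrymWeil.WeilTenfoldsSqrtMinus11) :
    ¬ _root_.HodgeConjecture := by
  intro hHC
  apply h
  intro A φ hdim _hφ c hrat hhodge _hweil
  have hsp : IsSmoothProjective 10 A.X := hdim ▸ (AbelianVariety.isSmoothProjective_holds (A := A))
  exact (hHC hsp).2 5 c hrat hhodge

/-- The summit-hard core of any counterexample: forget `φ` and the Weil plane. [cite: Deligne2000, §1] -/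
theorem not_hodgeConjecture_of_counterexample
    (h : ∃ (A : AbelianVariety ℂ) (c : complexBetti A.X 10), A.dim = 10 ∧ IsRationalClass c ∧
      IsOfHodgeType 10 A.X 10 5 5 c ∧ c ∉ algebraicClasses A.X 5) :
    ¬ _root_.HodgeConjecture := by
  rintro hHC
  obtain ⟨A, c, hdim, hrat, hhodge, hc⟩ := h
  have hsp : IsSmoothProjective 10 A.X := hdim ▸ (AbelianVariety.isSmoothProjective_holds (A := A))
  exact hc ((hHC hsp).2 5 c hrat hhodge)

/-- `¬ crux ⇒ ¬ HodgeWeilLadder` (target 1259): the crux is the instance `(p, g, n) = (11, 2, 5)` of the target,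
so killing the rung kills the target (coercions `((11:ℕ):ℤ)`, `Real.sqrt ((11:ℕ):ℝ)`, `2 * 5` line up by `simp`).
[folklore] -/
theorem not_hodgeWeilLadder_of_not
    (h : ¬ Summit.HodgeConjecture.HodgeConjecture.Theses.HeckePrymWeil.WeilTenfoldsSqrtMinus11) :
    ¬ Summit.HodgeConjecture.HodgeConjecture.Theses.HeckePrymWeil.HodgeWeilLadder := by
  intro hL
  apply h
  intro A φ hdim hφ c hrat hhodge hweil
  have h' := hL 11 (by norm_num) (by norm_num) (by norm_num) 2 le_rfl 5 (by norm_num) A φ hdim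
    (by simpa using hφ) c hrat hhodge
  simpa using h' hweil

/-! ### §A+ (cycle 2) Kill propagation along the `p = 11` ladder
LANDED as `Negative/KillPropagation` (p76316, accepted 2026-08-16); inline copies until the farm has built it. -/

/-- Pure logic of the ladder: a one-step descending rule lowers a rung predicate `P` from `a` to every
`b` with `1 ≤ b ≤ a`. [folklore] -/
theorem descend_logic (P : ℕ → Prop)
    (hDesc : ∀ n : ℕ, 1 ≤ n → (∀ m : ℕ, m = n + 1 → P m) → P n)
    {a b : ℕ} (hb : 1 ≤ b) (hab : b ≤ a) (ha : P a) : P b := by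
  obtain ⟨d, rfl⟩ : ∃ d, a = b + d := ⟨a - b, by omega⟩
  induction d generalizing b with
  | zero => simpa using ha
  | succ d ih =>
    exact hDesc b hb fun m hm => ih (by omega) (by omega) (by rw [hm]; convert ha using 1; omega)

/-- **(F6) Given `WeilDescending`, a kill of the crux kills EVERY higher rung of the `p = 11` ladder**:
for all `m ≥ 5`, `¬ crux → ¬ HWA(11, m)` (rung predicate of dimension `2m`, typed verbatim as in
`HodgeWeilLadder` / `WeilDescending`). In particular the twelvefold shadow `m = 6` of card
`weil-projector-graph-seeds` dies with the crux. [folklore] -/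
theorem not_hwa11_of_not (hD : Summit.HodgeConjecture.HodgeConjecture.Theses.HeckePrymWeil.WeilDescending)
    (h : ¬ Summit.HodgeConjecture.HodgeConjecture.Theses.HeckePrymWeil.WeilTenfoldsSqrtMinus11)
    {m : ℕ} (hm : 5 ≤ m) :
    ¬ (∀ (A : AbelianVariety ℂ) (φ : A ⟶ A), A.dim = (2 * m) →
        φ ≫ φ = -((((11 : ℕ) : ℤ)) • 𝟙 A) →
        ∀ c : complexBetti A.X (2 * m), IsRationalClass c → IsOfHodgeType (2 * m) A.X (2 * m) m m c →
          c ∈ Module.End.eigenspace (complexBetti.map (𝟙 A + φ).hom.hom.hom (2 * m)).hom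
                ((1 + Complex.I * (Real.sqrt ((11 : ℕ) : ℝ) : ℂ)) ^ (2 * m)) ⊔
              Module.End.eigenspace (complexBetti.map (𝟙 A + φ).hom.hom.hom (2 * m)).hom
                ((1 - Complex.I * (Real.sqrt ((11 : ℕ) : ℝ) : ℂ)) ^ (2 * m)) →
          c ∈ algebraicClasses A.X m) := by
  intro hM
  apply h
  have h5 := descend_logic _ (hD 11 (by norm_num) (by norm_num) (by norm_num)) (by norm_num) hm hM
  intro A φ hdim hφ c hrat hhodge hweil
  have h' := h5 A φ hdim (by simpa using hφ) c hrat hhodge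
  simpa using h' (by simpa using hweil)

/-- The Hecke–Prym rungs: `WeilDescending → ¬ crux → ¬ rung (11, g')` for every `g' ≥ 2`. [folklore] -/
theorem not_rung11_of_not (hD : Summit.HodgeConjecture.HodgeConjecture.Theses.HeckePrymWeil.WeilDescending)
    (h : ¬ Summit.HodgeConjecture.HodgeConjecture.Theses.HeckePrymWeil.WeilTenfoldsSqrtMinus11)
    {g : ℕ} (hg : 2 ≤ g) :
    ¬ (∀ n : ℕ, n = (11 - 1) / 2 * (g - 1) →
      ∀ (A : AbelianVariety ℂ) (φ : A ⟶ A), A.dim = (2 * n) →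
        φ ≫ φ = -((((11 : ℕ) : ℤ)) • 𝟙 A) →
        ∀ c : complexBetti A.X (2 * n), IsRationalClass c → IsOfHodgeType (2 * n) A.X (2 * n) n n c →
          c ∈ Module.End.eigenspace (complexBetti.map (𝟙 A + φ).hom.hom.hom (2 * n)).hom
                ((1 + Complex.I * (Real.sqrt ((11 : ℕ) : ℝ) : ℂ)) ^ (2 * n)) ⊔
              Module.End.eigenspace (complexBetti.map (𝟙 A + φ).hom.hom.hom (2 * n)).hom
                ((1 - Complex.I * (Real.sqrt ((11 : ℕ) : ℝ) : ℂ)) ^ (2 * n)) →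
          c ∈ algebraicClasses A.X n) := fun hR =>
  not_hwa11_of_not hD h (m := 5 * (g - 1)) (by omega) (hR _ (by norm_num))

/-! ## §B Load-bearing analysis: the crux with one hypothesis deleted -/

/-- `H_dim` deleted. Equivalent to the crux: a `HodgeModel 10 A.X` (inside `hhodge`) is a complex 10-manifold
homeomorphic to `A(ℂ)`, forcing `dim A = 10` by invariance of domain (`schemeDim = dim_ℂ A(ℂ)` for smooth
projective `A`; not in tree). [folklore] -/
def WithoutDim : Prop :=
  ∀ (A : AbelianVariety ℂ) (φ : A ⟶ A), φ ≫ φ = -((11 : ℤ) • 𝟙 A) →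
    ∀ c : complexBetti A.X 10, IsRationalClass c → IsOfHodgeType 10 A.X 10 5 5 c →
      c ∈ weilPlane A φ → c ∈ algebraicClasses A.X 5

/-- `WithoutDim` is formally stronger, so a kill of the crux kills it. [folklore] -/
theorem not_withoutDim_of_not
    (h : ¬ Summit.HodgeConjecture.HodgeConjecture.Theses.HeckePrymWeil.WeilTenfoldsSqrtMinus11) :
    ¬ WithoutDim :=
  fun hW => h fun A φ _ hφ c hrat hhodge hweil => hW A φ hφ c hrat hhodge hweil

/-- `H_phi` deleted (`φ` arbitrary). [folklore] -/
def WithoutPhi : Prop :=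
  ∀ (A : AbelianVariety ℂ) (φ : A ⟶ A), A.dim = 10 →
    ∀ c : complexBetti A.X 10, IsRationalClass c → IsOfHodgeType 10 A.X 10 5 5 c →
      c ∈ weilPlane A φ → c ∈ algebraicClasses A.X 5

/-- `WithoutPhi` is STILL a consequence of the summit: the endomorphism hypothesis carries no refutation
leverage (it is load-bearing only for the mechanism — it is what makes `weilPlane` the Weil plane of
`ℚ(√-11)`). [cite: Deligne2000, §1] -/
theorem not_hodgeConjecture_of_not_withoutPhi (h : ¬ WithoutPhi) : ¬ _root_.HodgeConjecture := by
  intro hHC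
  apply h
  intro A φ hdim c hrat hhodge _hweil
  have hsp : IsSmoothProjective 10 A.X := hdim ▸ (AbelianVariety.isSmoothProjective_holds (A := A))
  exact (hHC hsp).2 5 c hrat hhodge

/-- `H_rat` deleted (all complex `(5,5)`-classes of the Weil plane). Mathematically EQUIVALENT to the crux:
`algebraicClasses` is a `ℂ`-subspace and `weilPlane ∩ H^{5,5}` is spanned by rational classes (on Weil type the
whole plane is `(5,5)` and is `W_K ⊗ ℂ` with `W_K ⊆ H¹⁰(A, ℚ)` two-dimensional; off Weil type the `(5,5)`-part is
`0`). See `withoutRat_iff` (§E). [cite: vanGeemen1994HodgeAV, 4.9–4.10] -/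
def WithoutRat : Prop :=
  ∀ (A : AbelianVariety ℂ) (φ : A ⟶ A), A.dim = 10 → φ ≫ φ = -((11 : ℤ) • 𝟙 A) →
    ∀ c : complexBetti A.X 10, IsOfHodgeType 10 A.X 10 5 5 c →
      c ∈ weilPlane A φ → c ∈ algebraicClasses A.X 5

/-- `WithoutRat` is formally stronger, so a kill of the crux kills it. [folklore] -/
theorem not_withoutRat_of_not
    (h : ¬ Summit.HodgeConjecture.HodgeConjecture.Theses.HeckePrymWeil.WeilTenfoldsSqrtMinus11) :
    ¬ WithoutRat :=
  fun hW => h fun A φ hdim hφ c _ hhodge hweil => hW A φ hdim hφ c hhodge hweil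

/-- `H_type` deleted (all rational classes of the Weil plane). FALSE — see `withoutHodgeType_false` (§E) for the
CM witness `E¹⁰`; THE load-bearing hypothesis of the crux. [cite: vanGeemen1994HodgeAV, 4.9–4.10] -/
def WithoutHodgeType : Prop :=
  ∀ (A : AbelianVariety ℂ) (φ : A ⟶ A), A.dim = 10 → φ ≫ φ = -((11 : ℤ) • 𝟙 A) →
    ∀ c : complexBetti A.X 10, IsRationalClass c →
      c ∈ weilPlane A φ → c ∈ algebraicClasses A.X 5

/-- `WithoutHodgeType` is formally stronger, so a kill of the crux kills it. [folklore] -/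
theorem not_withoutHodgeType_of_not
    (h : ¬ Summit.HodgeConjecture.HodgeConjecture.Theses.HeckePrymWeil.WeilTenfoldsSqrtMinus11) :
    ¬ WithoutHodgeType :=
  fun hW => h fun A φ hdim hφ c hrat _ hweil => hW A φ hdim hφ c hrat hweil

/-- `H_eig` deleted: the Hodge conjecture in degree `10` for every tenfold with `√-11 ∈ End A`. OPEN and strictly
stronger than the crux (special members carry exceptional classes outside the Weil plane); still a consequence of
the summit (`not_hodgeConjecture_of_not_withoutWeilPlane`). [cite: Deligne2000, §1] -/
def WithoutWeilPlane : Prop :=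
  ∀ (A : AbelianVariety ℂ) (φ : A ⟶ A), A.dim = 10 → φ ≫ φ = -((11 : ℤ) • 𝟙 A) →
    ∀ c : complexBetti A.X 10, IsRationalClass c → IsOfHodgeType 10 A.X 10 5 5 c →
      c ∈ algebraicClasses A.X 5

/-- `WithoutWeilPlane` is still a consequence of the summit: no refutation leverage. [cite: Deligne2000, §1] -/
theorem not_hodgeConjecture_of_not_withoutWeilPlane (h : ¬ WithoutWeilPlane) : ¬ _root_.HodgeConjecture := by
  intro hHC
  apply h
  intro A φ hdim _hφ c hrat hhodge
  have hsp : IsSmoothProjective 10 A.X := hdim ▸ (AbelianVariety.isSmoothProjective_holds (A := A))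
  exact (hHC hsp).2 5 c hrat hhodge

/-- `WithoutWeilPlane` is formally stronger, so a kill of the crux kills it. [folklore] -/
theorem not_withoutWeilPlane_of_not
    (h : ¬ Summit.HodgeConjecture.HodgeConjecture.Theses.HeckePrymWeil.WeilTenfoldsSqrtMinus11) :
    ¬ WithoutWeilPlane :=
  fun hW => h fun A φ hdim hφ c hrat hhodge _ => hW A φ hdim hφ c hrat hhodge

/-! ## §C Typing and tightness: eigenvalue arithmetic (kernel-checked, LANDED)

All of §C is now the tree module
`Summits.HodgeConjecture.HodgeConjecture.Theorems.WeilTenfoldsSqrtMinus11.Negative.EigenvalueSeparation`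
(proposal p73707, ACCEPTED 2026-08-16, commit 9847aa4fb381): `weilXY`, `one_add_pow_eq`, `one_sub_pow_eq`,
`one_sub_pow_eq_one_add_pow_iff`, `weilXY_add`, `weilXY_norm`, `not_isSquare_one_add_of_prime`,
`weilXY_snd_ne_zero` (descent), `mixed_ne_plus_of_snd_ne_zero`, `mixed_ne_minus_of_snd_ne_zero`,
`weil_mixed_ne_plus`, `weil_mixed_ne_minus`, `weil_plus_pow_ne_minus_pow` (all primes `p ≠ 3`, all exponents),
`weilXY_eleven_snd_ne_zero`, `weil11_mixed_ne_plus`, `weil11_mixed_ne_minus`, `weil11_plus_ne_minus`,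
`weilXY_three_three`, `weil3_cube_collision`, `weil3_mixed_eq_plus`, and the summit-hardness theorems
`not_hodgeConjecture_of_not_weilTenfoldsSqrtMinus11`, `not_hodgeConjecture_of_exists_tenfold_counterexample`,
`not_weilTenfoldsSqrtMinus11_iff`, `exists_tenfold_counterexample_of_not`. They are re-exported into this
namespace below so that ideators' sketches can keep writing `Disproof.weil11_plus_ne_minus` etc. -/

export Summit.HodgeConjecture.HodgeConjecture.Theorems.WeilTenfoldsSqrtMinus11.Negative
  (weilXY one_add_pow_eq one_sub_pow_eq one_sub_pow_eq_one_add_pow_iff weilXY_add weilXY_norm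
    not_isSquare_one_add_of_prime weilXY_snd_ne_zero mixed_ne_plus_of_snd_ne_zero
    mixed_ne_minus_of_snd_ne_zero weil_mixed_ne_plus weil_mixed_ne_minus weil_plus_pow_ne_minus_pow
    weilXY_eleven_snd_ne_zero weil11_mixed_ne_plus weil11_mixed_ne_minus weil11_plus_ne_minus
    weilXY_three_three weil3_cube_collision weil3_mixed_eq_plus I_mul_sqrt_sq I_mul_sqrt_ne_zero
    one_add_I_mul_sqrt_ne_zero one_sub_I_mul_sqrt_ne_zero
    not_hodgeConjecture_of_not_weilTenfoldsSqrtMinus11 not_hodgeConjecture_of_exists_tenfold_counterexample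
    not_weilTenfoldsSqrtMinus11_iff exists_tenfold_counterexample_of_not)

/-- The natural strengthening "eigenvalue separation for EVERY `p ≥ 2`" is false: witness `p = 3`, `b = 3`.
[folklore] -/
theorem not_separation_all_p : ¬ ∀ p : ℕ, 2 ≤ p → ∀ b : ℕ, 1 ≤ b → (weilXY p b).2 ≠ 0 := by
  intro h
  exact h 3 (by norm_num) 3 (by norm_num) (by rw [show ((3 : ℕ) : ℤ) = 3 from rfl, weilXY_three_three])

/-! ## §G (cycle 2) The real structure of the typed Weil plane at `p = 11`

LANDED as `Negative/WeilPlaneReality` (p76415); the generic lemmas are the sibling crux 1261's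
(`WeilTwelvefoldsSqrtMinus7/Negative/WeilPlaneReality`), copied inline here so that this work file does not
depend on the farm's build state. Valid for EVERY abelian variety and EVERY endomorphism. -/

section Reality

open Complex Literature.AlgebraicTopology.SingularHomology

/-- Conjugation maps `Eig(f^*, μ)` into `Eig(f^*, conj μ)` for the pull-back along any continuous self-map
(naturality + conjugate-linearity of the tree's `conjClass`). [cite: VoisinHodgeI2002, Cor. 6.12] -/
theorem conjClass_mem_eigenspace_map {Y : Type} [TopologicalSpace Y] {k : ℕ} (f : C(Y, Y)) {μ : ℂ}
    {c : singularCohomology ℂ ℂ Y k}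
    (hc : c ∈ Module.End.eigenspace (singularCohomology.map ℂ ℂ f k).hom μ) :
    conjClass Y k c ∈ Module.End.eigenspace (singularCohomology.map ℂ ℂ f k).hom (starRingEnd ℂ μ) := by
  rw [Module.End.mem_eigenspace_iff] at hc ⊢
  have h := conjClass_map f (conjClass Y k c)
  rw [conjClass_conjClass] at h
  change (singularCohomology.map ℂ ℂ f k) (conjClass Y k c) = _
  have hc' : (singularCohomology.map ℂ ℂ f k) c = μ • c := hc
  apply (conjClassEquiv Y k).injective
  simp only [conjClassEquiv_apply]
  rw [h, hc', conjClass_smul, conjClass_conjClass]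
  simp

/-- Two eigenspaces of one endomorphism with distinct eigenvalues meet in `0`. [folklore] -/
theorem eq_zero_of_mem_eigenspace_of_mem_eigenspace {M : Type*} [AddCommGroup M] [Module ℂ M]
    (f : Module.End ℂ M) {μ ν : ℂ} (hμν : μ ≠ ν) {c : M}
    (hμ : c ∈ f.eigenspace μ) (hν : c ∈ f.eigenspace ν) : c = 0 := by
  rw [Module.End.mem_eigenspace_iff] at hμ hν
  have h : (μ - ν) • c = 0 := by rw [sub_smul, ← hμ, ← hν, sub_self]
  exact (smul_eq_zero.1 h).resolve_left (sub_ne_zero.2 hμν)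

/-- A RATIONAL class in an eigenspace of a pull-back for a NON-REAL eigenvalue is zero.
[cite: VoisinHodgeI2002, Cor. 6.12] -/
theorem eq_zero_of_isRationalClass_of_mem_eigenspace {Y : Type} [TopologicalSpace Y] {k : ℕ} (f : C(Y, Y))
    {μ : ℂ} (hμ : starRingEnd ℂ μ ≠ μ) {c : singularCohomology ℂ ℂ Y k} (hr : IsRationalClass c)
    (hc : c ∈ Module.End.eigenspace (singularCohomology.map ℂ ℂ f k).hom μ) : c = 0 := by
  have h := conjClass_mem_eigenspace_map f hc
  rw [hr.conjClass_eq] at h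
  exact eq_zero_of_mem_eigenspace_of_mem_eigenspace _ hμ h hc

/-- 2×2 inversion: with `f c_μ = μ c_μ`, `f c_ν = ν c_ν`, `μ ≠ ν`, `c = c_μ + c_ν`, both components lie in
`span_ℂ {c, f c}`. [folklore] -/
theorem components_mem_span_pair {M : Type*} [AddCommGroup M] [Module ℂ M]
    (f : Module.End ℂ M) {μ ν : ℂ} (hμν : μ ≠ ν) {c cμ cν : M}
    (hμ : cμ ∈ f.eigenspace μ) (hν : cν ∈ f.eigenspace ν) (hc : c = cμ + cν) :
    cμ ∈ Submodule.span ℂ {c, f c} ∧ cν ∈ Submodule.span ℂ {c, f c} := by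
  rw [Module.End.mem_eigenspace_iff] at hμ hν
  have hfc : f c = μ • cμ + ν • cν := by rw [hc, map_add, hμ, hν]
  have hd : μ - ν ≠ 0 := sub_ne_zero.2 hμν
  have hcmem : c ∈ Submodule.span ℂ {c, f c} := Submodule.subset_span (by simp)
  have hfmem : f c ∈ Submodule.span ℂ {c, f c} := Submodule.subset_span (by simp)
  constructor
  · have key : (μ - ν) • cμ = f c - ν • c := by
      rw [hfc, hc, sub_smul, smul_add]; abel
    have : cμ = (μ - ν)⁻¹ • (f c - ν • c) := by
      rw [← key, smul_smul, inv_mul_cancel₀ hd, one_smul]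
    rw [this]
    exact Submodule.smul_mem _ _ (Submodule.sub_mem _ hfmem (Submodule.smul_mem _ _ hcmem))
  · have key : (μ - ν) • cν = μ • c - f c := by
      rw [hfc, hc, sub_smul, smul_add]; abel
    have : cν = (μ - ν)⁻¹ • (μ • c - f c) := by
      rw [← key, smul_smul, inv_mul_cancel₀ hd, one_smul]
    rw [this]
    exact Submodule.smul_mem _ _ (Submodule.sub_mem _ (Submodule.smul_mem _ _ hcmem) hfmem)

/-- `conj √11 = √11` in `ℂ`. [folklore] -/
theorem conj_sqrt11 : starRingEnd ℂ ((Real.sqrt (11 : ℝ) : ℝ) : ℂ) = ((Real.sqrt (11 : ℝ) : ℝ) : ℂ) :=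
  Complex.conj_ofReal _

/-- `conj((1+i√11)^n) = (1-i√11)^n`. [folklore] -/
theorem conj_one_add_I_sqrt11_pow (n : ℕ) :
    starRingEnd ℂ ((1 + I * ((Real.sqrt (11 : ℝ) : ℝ) : ℂ)) ^ n) =
      (1 - I * ((Real.sqrt (11 : ℝ) : ℝ) : ℂ)) ^ n := by
  rw [map_pow, map_add, map_one, map_mul, Complex.conj_I, conj_sqrt11]
  ring

/-- `conj((1-i√11)^n) = (1+i√11)^n`. [folklore] -/
theorem conj_one_sub_I_sqrt11_pow (n : ℕ) :
    starRingEnd ℂ ((1 - I * ((Real.sqrt (11 : ℝ) : ℝ) : ℂ)) ^ n) =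
      (1 + I * ((Real.sqrt (11 : ℝ) : ℝ) : ℂ)) ^ n := by
  rw [map_pow, map_sub, map_one, map_mul, Complex.conj_I, conj_sqrt11]
  ring

/-- The typed eigenvalue `(1+i√11)¹⁰` is not real: its conjugate is the OTHER typed eigenvalue. [folklore] -/
theorem conj_weilEigenvalue_ten_ne :
    starRingEnd ℂ ((1 + I * ((Real.sqrt (11 : ℝ) : ℝ) : ℂ)) ^ 10) ≠
      (1 + I * ((Real.sqrt (11 : ℝ) : ℝ) : ℂ)) ^ 10 := by
  rw [conj_one_add_I_sqrt11_pow]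
  exact weil11_plus_ne_minus.symm

/-- Mirror: `conj((1-i√11)¹⁰) ≠ (1-i√11)¹⁰`. [folklore] -/
theorem conj_weilEigenvalueBar_ten_ne :
    starRingEnd ℂ ((1 - I * ((Real.sqrt (11 : ℝ) : ℝ) : ℂ)) ^ 10) ≠
      (1 - I * ((Real.sqrt (11 : ℝ) : ℝ) : ℂ)) ^ 10 := by
  rw [conj_one_sub_I_sqrt11_pow]
  exact weil11_plus_ne_minus

variable (A : AbelianVariety ℂ) (ψ : A ⟶ A)

/-- **A rational class in the `+` typed eigenspace ALONE is zero** (every `A`, every `ψ`).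
[cite: VoisinHodgeI2002, Cor. 6.12] -/
theorem rational_mem_plusEigenspace_eq_zero {c : complexBetti A.X 10} (hr : IsRationalClass c)
    (hc : c ∈ Module.End.eigenspace (complexBetti.map ψ.hom.hom.hom 10).hom
      ((1 + I * ((Real.sqrt (11 : ℝ) : ℝ) : ℂ)) ^ 10)) : c = 0 :=
  eq_zero_of_isRationalClass_of_mem_eigenspace _ conj_weilEigenvalue_ten_ne hr hc

/-- Mirror: a rational class in the `-` typed eigenspace alone is zero. [cite: VoisinHodgeI2002, Cor. 6.12] -/
theorem rational_mem_minusEigenspace_eq_zero {c : complexBetti A.X 10} (hr : IsRationalClass c)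
    (hc : c ∈ Module.End.eigenspace (complexBetti.map ψ.hom.hom.hom 10).hom
      ((1 - I * ((Real.sqrt (11 : ℝ) : ℝ) : ℂ)) ^ 10)) : c = 0 :=
  eq_zero_of_isRationalClass_of_mem_eigenspace _ conj_weilEigenvalueBar_ten_ne hr hc

/-- **(F7) Refuted-as-vacuous strengthening of the typing (`+` only).** The variant of the crux whose
Weil-plane hypothesis keeps only `Eig((𝟙+φ)^*, (1+i√11)¹⁰)` holds outright: every admissible class is `0`.
The `⊔` of both eigenspaces is essential; a line stub typed on one eigenline proves nothing. [folklore] -/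
theorem onlyPlusVariant_holds :
    ∀ (A : AbelianVariety ℂ) (φ : A ⟶ A), A.dim = 10 → φ ≫ φ = -((11 : ℤ) • 𝟙 A) →
      ∀ c : complexBetti A.X 10, IsRationalClass c → IsOfHodgeType 10 A.X 10 5 5 c →
        c ∈ Module.End.eigenspace (complexBetti.map (𝟙 A + φ).hom.hom.hom 10).hom
              ((1 + Complex.I * (Real.sqrt (11 : ℝ) : ℂ)) ^ 10) →
        c ∈ algebraicClasses A.X 5 := by
  intro A φ _ _ c hr _ hc
  rw [rational_mem_plusEigenspace_eq_zero A _ hr hc]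
  exact Submodule.zero_mem _

/-- **(F7) Refuted-as-vacuous strengthening of the typing (`-` only).** [folklore] -/
theorem onlyMinusVariant_holds :
    ∀ (A : AbelianVariety ℂ) (φ : A ⟶ A), A.dim = 10 → φ ≫ φ = -((11 : ℤ) • 𝟙 A) →
      ∀ c : complexBetti A.X 10, IsRationalClass c → IsOfHodgeType 10 A.X 10 5 5 c →
        c ∈ Module.End.eigenspace (complexBetti.map (𝟙 A + φ).hom.hom.hom 10).hom
              ((1 - Complex.I * (Real.sqrt (11 : ℝ) : ℂ)) ^ 10) →
        c ∈ algebraicClasses A.X 5 := by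
  intro A φ _ _ c hr _ hc
  rw [rational_mem_minusEigenspace_eq_zero A _ hr hc]
  exact Submodule.zero_mem _

/-- **The Weil components of a rational class are conjugate**: `c = c₊ + c₋` rational,
`c± ∈ Eig(ψ^*, (1 ± i√11)¹⁰)` ⇒ `conj c₊ = c₋`. [cite: VoisinHodgeI2002, Cor. 6.12] -/
theorem weilComponents_conj {c cp cm : complexBetti A.X 10} (hr : IsRationalClass c)
    (hp : cp ∈ Module.End.eigenspace (complexBetti.map ψ.hom.hom.hom 10).hom
      ((1 + I * ((Real.sqrt (11 : ℝ) : ℝ) : ℂ)) ^ 10))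
    (hm : cm ∈ Module.End.eigenspace (complexBetti.map ψ.hom.hom.hom 10).hom
      ((1 - I * ((Real.sqrt (11 : ℝ) : ℝ) : ℂ)) ^ 10))
    (hc : c = cp + cm) : conjClass _ 10 cp = cm := by
  have hp' := conjClass_mem_eigenspace_map _ hp
  have hm' := conjClass_mem_eigenspace_map _ hm
  rw [conj_one_add_I_sqrt11_pow] at hp'
  rw [conj_one_sub_I_sqrt11_pow] at hm'
  have hcc : conjClass _ 10 cp + conjClass _ 10 cm = cp + cm := by
    rw [← conjClass_add, ← hc, hr.conjClass_eq]
  have hd1 : conjClass _ 10 cp - cm ∈ Module.End.eigenspace (complexBetti.map ψ.hom.hom.hom 10).hom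
      ((1 - I * ((Real.sqrt (11 : ℝ) : ℝ) : ℂ)) ^ 10) := Submodule.sub_mem _ hp' hm
  have heq : conjClass _ 10 cp - cm = cp - conjClass _ 10 cm := by
    rw [sub_eq_sub_iff_add_eq_add, hcc]
  have hd2 : conjClass _ 10 cp - cm ∈ Module.End.eigenspace (complexBetti.map ψ.hom.hom.hom 10).hom
      ((1 + I * ((Real.sqrt (11 : ℝ) : ℝ) : ℂ)) ^ 10) := by
    rw [heq]; exact Submodule.sub_mem _ hp hm'
  exact sub_eq_zero.1 (eq_zero_of_mem_eigenspace_of_mem_eigenspace _ weil11_plus_ne_minus hd2 hd1)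

/-- **Refuted strengthening: rational components.** If `c₊` is itself rational then `c = 0`. [folklore] -/
theorem weilComponent_rational_imp_zero {c cp cm : complexBetti A.X 10} (hr : IsRationalClass c)
    (hp : cp ∈ Module.End.eigenspace (complexBetti.map ψ.hom.hom.hom 10).hom
      ((1 + I * ((Real.sqrt (11 : ℝ) : ℝ) : ℂ)) ^ 10))
    (hm : cm ∈ Module.End.eigenspace (complexBetti.map ψ.hom.hom.hom 10).hom
      ((1 - I * ((Real.sqrt (11 : ℝ) : ℝ) : ℂ)) ^ 10))
    (hc : c = cp + cm) (hpr : IsRationalClass cp) : c = 0 := by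
  have h0 : cp = 0 := rational_mem_plusEigenspace_eq_zero A ψ hpr hp
  have h1 := weilComponents_conj A ψ hr hp hm hc
  rw [h0, conjClass_zero] at h1
  rw [hc, h0, ← h1, add_zero]

/-- **Both components of a non-zero rational Weil class are non-zero** (shape of any counterexample).
[folklore] -/
theorem weilComponents_ne_zero {c cp cm : complexBetti A.X 10} (hr : IsRationalClass c)
    (hp : cp ∈ Module.End.eigenspace (complexBetti.map ψ.hom.hom.hom 10).hom
      ((1 + I * ((Real.sqrt (11 : ℝ) : ℝ) : ℂ)) ^ 10))
    (hm : cm ∈ Module.End.eigenspace (complexBetti.map ψ.hom.hom.hom 10).hom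
      ((1 - I * ((Real.sqrt (11 : ℝ) : ℝ) : ℂ)) ^ 10))
    (hc : c = cp + cm) (h0 : c ≠ 0) : cp ≠ 0 ∧ cm ≠ 0 := by
  have hconj := weilComponents_conj A ψ hr hp hm hc
  constructor
  · intro hp0
    apply h0
    rw [hc, hp0, ← hconj, hp0, conjClass_zero, add_zero]
  · intro hm0
    apply h0
    have : cp = 0 := by
      have h := congrArg (conjClass _ 10) hconj
      rw [conjClass_conjClass, hm0, conjClass_zero] at h
      exact h
    rw [hc, this, hm0, add_zero]

/-- **2×2 inversion at `p = 11`**: both Weil components of `c` lie in `span_ℂ {c, ψ^* c}`. [folklore] -/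
theorem weilComponents_mem_span_pair {c cp cm : complexBetti A.X 10}
    (hp : cp ∈ Module.End.eigenspace (complexBetti.map ψ.hom.hom.hom 10).hom
      ((1 + I * ((Real.sqrt (11 : ℝ) : ℝ) : ℂ)) ^ 10))
    (hm : cm ∈ Module.End.eigenspace (complexBetti.map ψ.hom.hom.hom 10).hom
      ((1 - I * ((Real.sqrt (11 : ℝ) : ℝ) : ℂ)) ^ 10))
    (hc : c = cp + cm) :
    cp ∈ Submodule.span ℂ {c, (complexBetti.map ψ.hom.hom.hom 10).hom c} ∧
      cm ∈ Submodule.span ℂ {c, (complexBetti.map ψ.hom.hom.hom 10).hom c} :=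
  components_mem_span_pair _ weil11_plus_ne_minus hp hm hc

/-! ### (F7') The plane is the kernel of an integral quadratic (LANDED `Negative/WeilPlaneKernel`, p76722; inline copies) -/

/-- **`Eig(f, μ) ⊔ Eig(f, ν) = ker (f² - (μ+ν) f + μν)` for `μ ≠ ν`** (kernel lemma for the coprime
factors `X - μ`, `X - ν`, proved by the explicit 2×2 inversion). [folklore] -/
theorem eigenspace_sup_eigenspace_eq_ker {M : Type*} [AddCommGroup M] [Module ℂ M]
    (f : Module.End ℂ M) {μ ν : ℂ} (hμν : μ ≠ ν) :
    f.eigenspace μ ⊔ f.eigenspace ν = LinearMap.ker (f * f - (μ + ν) • f + (μ * ν) • 1) := by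
  ext c
  rw [Submodule.mem_sup, LinearMap.mem_ker]
  constructor
  · rintro ⟨y, hy, z, hz, rfl⟩
    rw [Module.End.mem_eigenspace_iff] at hy hz
    simp only [LinearMap.add_apply, LinearMap.sub_apply, LinearMap.smul_apply, Module.End.mul_apply,
      Module.End.one_apply, map_add, hy, hz, map_smul, smul_smul]
    module
  · intro h
    have hd : μ - ν ≠ 0 := sub_ne_zero.2 hμν
    have h' : f (f c) - (μ + ν) • f c + (μ * ν) • c = 0 := by
      simpa [LinearMap.add_apply, LinearMap.sub_apply, Module.End.mul_apply] using h
    have hff : f (f c) = (μ + ν) • f c - (μ * ν) • c := by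
      rw [← sub_eq_zero]
      convert h' using 1
      module
    refine ⟨(μ - ν)⁻¹ • (f c - ν • c), ?_, (μ - ν)⁻¹ • (μ • c - f c), ?_, ?_⟩
    · rw [Module.End.mem_eigenspace_iff, map_smul, map_sub, map_smul, hff]
      module
    · rw [Module.End.mem_eigenspace_iff, map_smul, map_sub, map_smul, hff]
      module
    · rw [← smul_add]
      have : f c - ν • c + (μ • c - f c) = (μ - ν) • c := by module
      rw [this, smul_smul, inv_mul_cancel₀ hd, one_smul]

/-! #### The integers of the crux: `λ = (1+i√11)¹⁰ = 243200 + 15872·i√11`, `λ + λ̄ = 486400`, `λ λ̄ = 12¹⁰` -/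

/-- `weilXY 11 10 = (243200, 15872)`. [folklore] -/
theorem weilXY_eleven_ten : weilXY 11 10 = (243200, 15872) := by decide

/-- `(1+i√11)¹⁰ = 243200 + 15872·i√11`. [folklore] -/
theorem weilEigenvalue_ten_eq :
    (1 + I * ((Real.sqrt (11 : ℝ) : ℝ) : ℂ)) ^ 10 = 243200 + 15872 * (I * ((Real.sqrt (11 : ℝ) : ℝ) : ℂ)) := by
  have h := one_add_pow_eq ((11 : ℕ) : ℤ) (I * ((Real.sqrt ((11 : ℕ) : ℝ) : ℝ) : ℂ)) (I_mul_sqrt_sq 11) 10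
  simp only [Nat.cast_ofNat] at h
  rw [weilXY_eleven_ten] at h
  push_cast at h
  simpa using h

/-- `(1-i√11)¹⁰ = 243200 - 15872·i√11`. [folklore] -/
theorem weilEigenvalueBar_ten_eq :
    (1 - I * ((Real.sqrt (11 : ℝ) : ℝ) : ℂ)) ^ 10 = 243200 - 15872 * (I * ((Real.sqrt (11 : ℝ) : ℝ) : ℂ)) := by
  have h := one_sub_pow_eq ((11 : ℕ) : ℤ) (I * ((Real.sqrt ((11 : ℕ) : ℝ) : ℝ) : ℂ)) (I_mul_sqrt_sq 11) 10
  simp only [Nat.cast_ofNat] at h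
  rw [weilXY_eleven_ten] at h
  push_cast at h
  simpa using h

/-- Trace: `(1+i√11)¹⁰ + (1-i√11)¹⁰ = 486400 ∈ ℤ`. [folklore] -/
theorem weilEigenvalues_ten_add :
    (1 + I * ((Real.sqrt (11 : ℝ) : ℝ) : ℂ)) ^ 10 + (1 - I * ((Real.sqrt (11 : ℝ) : ℝ) : ℂ)) ^ 10 = 486400 := by
  rw [weilEigenvalue_ten_eq, weilEigenvalueBar_ten_eq]; ring

/-- Norm: `(1+i√11)¹⁰ (1-i√11)¹⁰ = 12¹⁰ = 61917364224 ∈ ℤ`. [folklore] -/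
theorem weilEigenvalues_ten_mul :
    (1 + I * ((Real.sqrt (11 : ℝ) : ℝ) : ℂ)) ^ 10 * (1 - I * ((Real.sqrt (11 : ℝ) : ℝ) : ℂ)) ^ 10 = 61917364224 := by
  rw [← mul_pow]
  have h : (1 + I * ((Real.sqrt (11 : ℝ) : ℝ) : ℂ)) * (1 - I * ((Real.sqrt (11 : ℝ) : ℝ) : ℂ)) = 12 := by
    have hsq : (I * ((Real.sqrt (11 : ℝ) : ℝ) : ℂ)) ^ 2 = -11 := by
      have := I_mul_sqrt_sq 11
      push_cast at this
      simpa using this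
    linear_combination (exp := 1) (-1 : ℂ) * hsq
  rw [h]; norm_num



/-- **The typed Weil plane of the crux is the kernel of an INTEGRAL quadratic in `(𝟙+φ)^*`**:
`Eig((𝟙+φ)^*, (1+i√11)¹⁰) ⊔ Eig((𝟙+φ)^*, (1-i√11)¹⁰) = ker (T² - 486400·T + 61917364224)`,
`T = (𝟙+φ)^*` on `H¹⁰(A(ℂ); ℂ)` — for EVERY abelian variety `A` and EVERY `φ` (no dimension, no Weil
relation). Consequences: membership in the plane is ONE linear equation with integer coefficients in a
pull-back (so the plane is Galois/conjugation-stable and is `W ⊗ ℂ` for the ℚ-subspace `W = ker` of the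
same operator on rational cohomology as soon as a ℚ-form of `complexBetti` is available — the missing
input of the work file's near-miss `withoutRat_iff`); a refuter's witness must solve `T²c - 486400·Tc +
12¹⁰ c = 0`. [folklore] -/
theorem weilPlane_eq_ker_quadratic (A : AbelianVariety ℂ) (φ : A ⟶ A) :
    Module.End.eigenspace (complexBetti.map (CategoryStruct.id A + φ).hom.hom.hom 10).hom
          ((1 + Complex.I * (Real.sqrt (11 : ℝ) : ℂ)) ^ 10) ⊔
        Module.End.eigenspace (complexBetti.map (CategoryStruct.id A + φ).hom.hom.hom 10).hom
          ((1 - Complex.I * (Real.sqrt (11 : ℝ) : ℂ)) ^ 10) =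
      LinearMap.ker
        ((complexBetti.map (CategoryStruct.id A + φ).hom.hom.hom 10).hom *
            (complexBetti.map (CategoryStruct.id A + φ).hom.hom.hom 10).hom -
          (486400 : ℂ) • (complexBetti.map (CategoryStruct.id A + φ).hom.hom.hom 10).hom +
          (61917364224 : ℂ) • 1) := by
  rw [eigenspace_sup_eigenspace_eq_ker _ weil11_plus_ne_minus, weilEigenvalues_ten_add,
    weilEigenvalues_ten_mul]

end Reality

/-! ## §H (cycle 2) Typing of the cyclotomic anchor stubs (cards 1–4) and the purity design

LANDED as `Negative/AnchorTyping` (p76314, accepted 2026-08-16): the first six theorems below (inline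
copies). Work-file only: the verbatim copies `zeta11`, `embed`, `squares11`, `GaussPeriodDesign` of
`SketchIdeatorOne` (card `quaternionic-norm-anchors`) with `embed_eq_zero_iff` and
`not_gaussPeriodDesign_one`, `not_gaussPeriodDesign_two`. -/

section AnchorTyping

open Complex

/-- For a complex root of unity, `conj x = x⁻¹`. [folklore] -/
theorem conj_eq_inv_of_pow_eq_one {x : ℂ} {n : ℕ} (hn : n ≠ 0) (hx : x ^ n = 1) :
    starRingEnd ℂ x = x⁻¹ :=
  (Complex.inv_eq_conj (Complex.norm_eq_one_of_pow_eq_one hx hn)).symm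

/-- For `n` odd, `-1` is not an `n`-th root of unity: `x ^ n = 1 → 1 + x ≠ 0`. [folklore] -/
theorem one_add_ne_zero_of_pow_eq_one_odd {x : ℂ} {n : ℕ} (hn : Odd n) (hx : x ^ n = 1) :
    1 + x ≠ 0 := by
  intro h
  have hx' : x = -1 := by linear_combination h
  rw [hx', hn.neg_one_pow] at hx
  norm_num at hx

/-- Pure algebra: `v + w = 2u` and `v w = u²` force `v = w = u`. [folklore] -/
theorem eq_of_add_eq_two_mul_of_mul_eq_sq {v w u : ℂ} (hs : v + w = 2 * u) (hp : v * w = u ^ 2) :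
    v = u ∧ w = u := by
  have hv : (v - u) ^ 2 = 0 := by linear_combination v * hs - hp
  have hv' : v = u := by
    have := pow_eq_zero_iff (n := 2) (by norm_num) |>.1 hv
    linear_combination this
  refine ⟨hv', ?_⟩
  rw [hv'] at hs
  linear_combination hs

/-- **(F8 i) Collision-freeness of the anchor typing on `∧²H¹`.** For `n` odd and `n`-th roots of unity
`u, v, w ∈ ℂ` (the value `1` allowed): `(1 + v)(1 + w) = (1 + u)²` forces `v = w = u`. So the
`(1+u)²`-eigenspace of `(𝟙+ψ)^*` on `∧²H¹ = ⊕ U_v ⊗ U_w` is exactly `∧²U_u`: `SignatureOneOne` /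
`cycloDivisorLine` type what the cards say. [folklore] -/
theorem rootOfUnity_one_add_mul_collision_free {n : ℕ} (hn : Odd n) {u v w : ℂ}
    (hu : u ^ n = 1) (hv : v ^ n = 1) (hw : w ^ n = 1)
    (h : (1 + v) * (1 + w) = (1 + u) ^ 2) : v = u ∧ w = u := by
  have hn0 : n ≠ 0 := by rintro rfl; exact (Nat.not_odd_zero hn).elim
  have hu0 : u ≠ 0 := ne_zero_pow hn0 (hu ▸ one_ne_zero)
  have hv0 : v ≠ 0 := ne_zero_pow hn0 (hv ▸ one_ne_zero)
  have hw0 : w ≠ 0 := ne_zero_pow hn0 (hw ▸ one_ne_zero)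
  have hc : (1 + v⁻¹) * (1 + w⁻¹) = (1 + u⁻¹) ^ 2 := by
    have := congrArg (starRingEnd ℂ) h
    simpa [map_mul, map_add, map_pow, conj_eq_inv_of_pow_eq_one hn0 hu,
      conj_eq_inv_of_pow_eq_one hn0 hv, conj_eq_inv_of_pow_eq_one hn0 hw] using this
  have hc' : (1 + v) * (1 + w) * u ^ 2 = (1 + u) ^ 2 * (v * w) := by
    field_simp at hc
    linear_combination hc
  have hP : (1 + u) ^ 2 ≠ 0 := pow_ne_zero _ (one_add_ne_zero_of_pow_eq_one_odd hn hu)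
  have hprod : v * w = u ^ 2 := by
    rw [h] at hc'
    exact (mul_left_cancel₀ hP hc').symm
  have hsum : v + w = 2 * u := by
    have : (1 + v) * (1 + w) = 1 + (v + w) + v * w := by ring
    rw [this, hprod] at h
    linear_combination h
  exact eq_of_add_eq_two_mul_of_mul_eq_sq hsum hprod

/-- The even case really collides: `n = 2`, `u = v = -1`, `w = 1`. [folklore] -/
theorem collision_at_even : ((1 : ℂ) + (-1)) * (1 + 1) = (1 + (-1)) ^ 2 ∧ ((-1 : ℂ)) ^ 2 = 1 ∧
    ((1 : ℂ)) ^ 2 = 1 ∧ (1 : ℂ) ≠ -1 := by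
  refine ⟨by norm_num, by norm_num, by norm_num, by norm_num⟩

/-- **(F8 i) No eigenvalue-`1` interference, I.** `n` odd, `u ∈ μ_n`, `u ≠ 1`: `(1+u)² ≠ 4`. [folklore] -/
theorem one_add_sq_ne_four {n : ℕ} (hn : Odd n) {u : ℂ} (hu : u ^ n = 1) (hu1 : u ≠ 1) :
    (1 + u) ^ 2 ≠ 4 := by
  intro h
  have h' : (1 + u) * (1 + u) = (1 + (1 : ℂ)) ^ 2 := by rw [← sq, h]; norm_num
  exact hu1 (rootOfUnity_one_add_mul_collision_free hn (one_pow n) hu hu h').1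

/-- **(F8 i) No eigenvalue-`1` interference, II.** `n` odd, `u, v ∈ μ_n`, `u ≠ 1`:
`2(1+v) ≠ (1+u)²`. [folklore] -/
theorem two_mul_one_add_ne_one_add_sq {n : ℕ} (hn : Odd n) {u v : ℂ} (hu : u ^ n = 1)
    (hv : v ^ n = 1) (hu1 : u ≠ 1) : 2 * (1 + v) ≠ (1 + u) ^ 2 := by
  intro h
  have h' : (1 + (1 : ℂ)) * (1 + v) = (1 + u) ^ 2 := by rw [← h]; norm_num
  exact hu1 (rootOfUnity_one_add_mul_collision_free hn hu (one_pow n) hv h').1.symm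

/-- `𝔤 z` = the quadratic Gauss sum `Σ_{k=1}^{10} (k|11) zᵏ` (local notation, not a definition). -/
local notation "𝔤 " z:max => (z + z ^ 3 + z ^ 4 + z ^ 5 + z ^ 9 - z ^ 2 - z ^ 6 - z ^ 7 - z ^ 8 - z ^ 10)

open Polynomial in
/-- In `ℤ[X]`: `g(X)² + 11 - (1 + X + ⋯ + X¹⁰) = (X¹¹ - 1)·q(X)` for an explicit `q`. [folklore] -/
theorem gaussSum11_poly_identity :
    (𝔤 (X : ℤ[X])) ^ 2 + 11 - (Finset.range 11).sum (fun k => (X : ℤ[X]) ^ k) =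
      (X ^ 11 - 1) * (X ^ 9 - 2 * X ^ 8 + 3 * X ^ 7 + X ^ 5 - 2 * X ^ 4 + 3 * X ^ 3
        + X - 10) := by
  simp only [Finset.sum_range_succ, Finset.sum_range_zero]
  ring

/-- **(F8 ii) `g(z)² = -11 + Σ_{k<11} zᵏ` whenever `z¹¹ = 1`, in ANY ring** (e.g. `End A`). Hence, given
`ψ¹¹ = 𝟙`, `φ = g(ψ)` has `φ ≫ φ = -11` iff the norm `Σ ψᵏ` vanishes: THIS is what excludes the junk model
`B⁵ × (CM fivefold)`, `ψ = 𝟙 × ζ`, from `CyclotomicNormAnchor` — not `SignatureOneOne`. [folklore] -/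
theorem gaussSum11_sq {R : Type*} [Ring R] (z : R) (h11 : z ^ 11 = 1) :
    (𝔤 z) * (𝔤 z) = -11 + (Finset.range 11).sum (fun k => z ^ k) := by
  have key := congrArg (Polynomial.aeval (R := ℤ) z) gaussSum11_poly_identity
  simp only [map_sub, map_add, map_mul, map_pow, map_sum, Polynomial.aeval_X, map_ofNat,
    map_one, h11, sub_self, zero_mul] at key
  rw [← sq]
  have h2 : (𝔤 z) ^ 2 + 11 = (Finset.range 11).sum (fun k => z ^ k) := sub_eq_zero.1 key
  rw [← h2]
  abel

/-- Given `z¹¹ = 1`: `g(z)² = -11 ↔ Σ_{k<11} zᵏ = 0`. [folklore] -/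
theorem gaussSum11_sq_eq_neg_eleven_iff {R : Type*} [Ring R] (z : R) (h11 : z ^ 11 = 1) :
    (𝔤 z) * (𝔤 z) = -11 ↔ (Finset.range 11).sum (fun k => z ^ k) = 0 := by
  rw [gaussSum11_sq z h11]
  constructor
  · intro h
    have := congrArg (fun x => 11 + x) h
    simpa using this
  · intro h
    rw [h, add_zero]

/-! ### The purity design of card `quaternionic-norm-anchors` (verbatim copies of the sketch's definitions) -/

/-- `ζ₁₁ = exp(2πi/11) ∈ ℂ` (verbatim `SketchIdeatorOne.zeta11`). [folklore] -/
abbrev zeta11 : ℂ := Complex.exp (2 * Real.pi * Complex.I / 11)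

/-- `σ_a(Σ_j q_j ζʲ) = Σ_j q_j ζ^{aj}` (verbatim `SketchIdeatorOne.embed`). [folklore] -/
abbrev embed (q : Fin 10 → ℚ) (a : ZMod 11) : ℂ :=
  ∑ j : Fin 10, (q j : ℂ) * zeta11 ^ (a.val * (j : ℕ))

/-- The squares of `(ℤ/11)ˣ` (verbatim `SketchIdeatorOne.squares11`). [folklore] -/
abbrev squares11 : Finset (ZMod 11)ˣ := Finset.univ.filter fun a => IsSquare a

/-- VERBATIM copy of `SketchIdeatorOne.GaussPeriodDesign` (card `quaternionic-norm-anchors`, second stub):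
`r` terms `(s_t, n_t, λ_t)` whose weighted partial norms vanish on every "bad" set of embeddings in every
admissible `θ`-degree, with non-zero `□`-partial norm. [folklore] -/
def GaussPeriodDesign (r : ℕ) : Prop :=
  ∃ (s n : Fin r → ℤ) (q : Fin r → Fin 10 → ℚ),
    (∀ S : Finset (ZMod 11)ˣ, S.Nonempty → S ≠ Finset.univ → S ≠ squares11 → S ≠ squares11ᶜ →
      ∀ k : ℕ, k + S.card ≤ 10 →
        ∑ t, (s t : ℂ) * (n t : ℂ) ^ k * ∏ a ∈ S, embed (q t) (a : ZMod 11) = 0) ∧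
    ∑ t, (s t : ℂ) * ∏ a ∈ squares11, embed (q t) (a : ZMod 11) ≠ 0

/-- `ζ₁₁` is a primitive 11th root of unity. [folklore] -/
theorem zeta11_isPrimitiveRoot : IsPrimitiveRoot zeta11 11 := by
  simpa using Complex.isPrimitiveRoot_exp 11 (by norm_num)

open Polynomial in
/-- The polynomial `P_q = Σ_j q_j Xʲ ∈ ℚ[X]` (degree `≤ 9`) with `σ_a(λ_q) = P_q(ζ^a)`. [folklore] -/
def designPoly (q : Fin 10 → ℚ) : ℚ[X] := ∑ j : Fin 10, Polynomial.C (q j) * Polynomial.X ^ (j : ℕ)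

theorem embed_eq_aeval (q : Fin 10 → ℚ) (a : ZMod 11) :
    embed q a = Polynomial.aeval (zeta11 ^ a.val) (designPoly q) := by
  simp [embed, designPoly, map_sum, Polynomial.aeval_C, pow_mul]

theorem coeff_designPoly (q : Fin 10 → ℚ) (j : Fin 10) : (designPoly q).coeff j = q j := by
  simp only [designPoly, Polynomial.finsetSum_coeff, Polynomial.coeff_C_mul, Polynomial.coeff_X_pow]
  rw [Finset.sum_eq_single j]
  · simp
  · intro b _ hb
    have : (j : ℕ) ≠ (b : ℕ) := fun h => hb (Fin.ext h).symm
    simp [this]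
  · intro h; exact absurd (Finset.mem_univ j) h

theorem natDegree_designPoly_lt (q : Fin 10 → ℚ) : (designPoly q).natDegree < 10 := by
  have h : (designPoly q).natDegree ≤ 9 := by
    unfold designPoly
    refine Polynomial.natDegree_sum_le_of_forall_le _ _ fun j _ => ?_
    calc (Polynomial.C (q j) * Polynomial.X ^ (j : ℕ)).natDegree ≤ (j : ℕ) :=
          Polynomial.natDegree_C_mul_X_pow_le _ _
      _ ≤ 9 := by omega
  omega

/-- **Injectivity of the embeddings**: for a unit `a`, `σ_a(λ) = 0 ↔ λ = 0` (`ζ^a` is a primitive 11th root of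
unity, `minpoly_ℚ = Φ₁₁` of degree `10 > deg P_q`). So a term with `λ_t = 0` contributes nothing to a design,
and a term with `λ_t ≠ 0` has ALL its partial norms non-zero. [folklore] -/
theorem embed_eq_zero_iff (q : Fin 10 → ℚ) (a : (ZMod 11)ˣ) : embed q (a : ZMod 11) = 0 ↔ q = 0 := by
  constructor
  · intro h
    rw [embed_eq_aeval] at h
    have hprim : IsPrimitiveRoot (zeta11 ^ (a : ZMod 11).val) 11 := by
      refine zeta11_isPrimitiveRoot.pow_of_coprime _ ?_
      have hval : ((a : ZMod 11).val : ZMod 11) = (a : ZMod 11) := ZMod.natCast_zmod_val _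
      have hu : IsUnit (((a : ZMod 11).val : ZMod 11)) := by rw [hval]; exact Units.isUnit a
      exact (ZMod.isUnit_iff_coprime _ _).1 hu
    by_contra hq
    have hP : designPoly q ≠ 0 := by
      intro h0
      apply hq
      funext j
      have := coeff_designPoly q j
      rw [h0, Polynomial.coeff_zero] at this
      exact_mod_cast this.symm
    have hmin : minpoly ℚ (zeta11 ^ (a : ZMod 11).val) = Polynomial.cyclotomic 11 ℚ :=
      (Polynomial.cyclotomic_eq_minpoly_rat hprim (by norm_num)).symm
    have hdeg : (minpoly ℚ (zeta11 ^ (a : ZMod 11).val)).natDegree = 10 := by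
      rw [hmin, Polynomial.natDegree_cyclotomic]; rfl
    have hle : (minpoly ℚ (zeta11 ^ (a : ZMod 11).val)).natDegree ≤ (designPoly q).natDegree :=
      Polynomial.natDegree_le_natDegree (minpoly.degree_le_of_ne_zero ℚ _ hP h)
    have := natDegree_designPoly_lt q
    omega
  · intro h
    subst h
    simp [embed]

/-- `1 ∈ □`. [folklore] -/
theorem one_mem_squares11 : (1 : (ZMod 11)ˣ) ∈ squares11 := by
  simp only [squares11, Finset.mem_filter, Finset.mem_univ, true_and]
  exact ⟨1, by simp⟩

/-- **(F8 iii) The purity design is impossible with ONE term**: `¬ GaussPeriodDesign 1`. With `r = 1` the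
non-vanishing of the `□`-partial norm forces `s₀ ≠ 0`, `λ₀ ≠ 0`, and then the bad singleton `S = {1}`,
`k = 0`, demands `s₀ σ₁(λ₀) = 0` — contradicting injectivity of `σ₁`. [folklore] -/
theorem not_gaussPeriodDesign_one : ¬ GaussPeriodDesign 1 := by
  rintro ⟨s, n, q, hbad, hgood⟩
  have hq : q 0 ≠ 0 := by
    intro h0
    apply hgood
    simp only [Finset.univ_unique, Fin.default_eq_zero, Finset.sum_singleton]
    rw [Finset.prod_eq_zero one_mem_squares11 (by rw [embed_eq_zero_iff]; exact h0), mul_zero]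
  have h3sq : IsSquare ((ZMod.unitOfCoprime 3 (by norm_num : Nat.Coprime 3 11)) : (ZMod 11)ˣ) :=
    ⟨ZMod.unitOfCoprime 5 (by norm_num : Nat.Coprime 5 11), by ext; decide⟩
  have hne_sq : ({1} : Finset (ZMod 11)ˣ) ≠ squares11 := by
    intro h
    have hmem : (ZMod.unitOfCoprime 3 (by norm_num : Nat.Coprime 3 11)) ∈ squares11 := by
      simp only [squares11, Finset.mem_filter, Finset.mem_univ, true_and]; exact h3sq
    rw [← h, Finset.mem_singleton] at hmem
    have := congrArg (fun u : (ZMod 11)ˣ => (u : ZMod 11)) hmem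
    exact absurd this (by decide)
  have hne_cpl : ({1} : Finset (ZMod 11)ˣ) ≠ squares11ᶜ := by
    intro h
    have hmem : (1 : (ZMod 11)ˣ) ∈ squares11ᶜ := by rw [← h]; simp
    rw [Finset.mem_compl] at hmem
    exact hmem one_mem_squares11
  have hne_univ : ({1} : Finset (ZMod 11)ˣ) ≠ Finset.univ := by
    intro h
    have hcard := congrArg Finset.card h
    rw [Finset.card_singleton, Finset.card_univ, ZMod.card_units_eq_totient] at hcard
    norm_num [Nat.totient_prime (by norm_num : Nat.Prime 11)] at hcard
  have h := hbad {1} (by simp) hne_univ hne_sq hne_cpl 0 (by simp)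
  simp only [Finset.univ_unique, Fin.default_eq_zero, Finset.sum_singleton, pow_zero, mul_one,
    Finset.prod_singleton, Units.val_one] at h
  rcases mul_eq_zero.1 h with hs | he
  · apply hgood
    simp only [Finset.univ_unique, Fin.default_eq_zero, Finset.sum_singleton]
    rw [hs, zero_mul]
  · have : embed (q 0) ((1 : (ZMod 11)ˣ) : ZMod 11) = 0 := by simpa using he
    exact hq ((embed_eq_zero_iff (q 0) 1).1 this)

/-- The unit `2 ∈ (ℤ/11)ˣ`. [folklore] -/
def u2 : (ZMod 11)ˣ := ZMod.unitOfCoprime 2 (by norm_num : Nat.Coprime 2 11)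
/-- The unit `3 = 5² ∈ (ℤ/11)ˣ`, a square. [folklore] -/
def u3 : (ZMod 11)ˣ := ZMod.unitOfCoprime 3 (by norm_num : Nat.Coprime 3 11)

/-- `3 ∈ □`. [folklore] -/
theorem u3_mem_squares11 : u3 ∈ squares11 := by
  simp only [squares11, Finset.mem_filter, Finset.mem_univ, true_and]
  exact ⟨ZMod.unitOfCoprime 5 (by norm_num : Nat.Coprime 5 11), by ext; decide⟩

/-- `3 ≠ 1`. [folklore] -/
theorem u3_ne_one : u3 ≠ 1 := by
  intro h; have := congrArg (fun u : (ZMod 11)ˣ => (u : ZMod 11)) h; exact absurd this (by decide)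
/-- `3 ≠ 2`. [folklore] -/
theorem u3_ne_u2 : u3 ≠ u2 := by
  intro h; have := congrArg (fun u : (ZMod 11)ˣ => (u : ZMod 11)) h; exact absurd this (by decide)
/-- `2 ≠ 1`. [folklore] -/
theorem u2_ne_one : u2 ≠ 1 := by
  intro h; have := congrArg (fun u : (ZMod 11)ˣ => (u : ZMod 11)) h; exact absurd this (by decide)

/-- A set `S` with `1 ∈ S`, `3 ∉ S`, `|S| ≤ 2` is a "bad" set of embeddings (neither `∅`, all, `□`, nor `⊠`). [folklore] -/
theorem bad_of {S : Finset (ZMod 11)ˣ} (h1 : (1 : (ZMod 11)ˣ) ∈ S) (h3 : u3 ∉ S) (hc : S.card ≤ 2) :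
    S.Nonempty ∧ S ≠ Finset.univ ∧ S ≠ squares11 ∧ S ≠ squares11ᶜ := by
  refine ⟨⟨1, h1⟩, ?_, ?_, ?_⟩
  · intro h
    have := congrArg Finset.card h
    rw [Finset.card_univ, ZMod.card_units_eq_totient] at this
    norm_num [Nat.totient_prime (by norm_num : Nat.Prime 11)] at this
    omega
  · intro h; rw [h] at h3; exact h3 u3_mem_squares11
  · intro h
    have : (1 : (ZMod 11)ˣ) ∈ squares11ᶜ := h ▸ h1
    rw [Finset.mem_compl] at this
    exact this one_mem_squares11

/-- `σ_a` is ℚ-linear: scaling. [folklore] -/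
theorem embed_smul (c : ℚ) (q : Fin 10 → ℚ) (a : ZMod 11) : embed (c • q) a = (c : ℂ) * embed q a := by
  simp only [embed, Pi.smul_apply, smul_eq_mul, Rat.cast_mul, Finset.mul_sum]
  refine Finset.sum_congr rfl fun j _ => by ring

/-- `σ_a` is ℚ-linear: differences. [folklore] -/
theorem embed_sub (q q' : Fin 10 → ℚ) (a : ZMod 11) : embed (q - q') a = embed q a - embed q' a := by
  simp only [embed, Pi.sub_apply, Rat.cast_sub, ← Finset.sum_sub_distrib]
  refine Finset.sum_congr rfl fun j _ => by ring

/-- Partial norms scale by `c^{|S|}`. [folklore] -/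
theorem prod_embed_smul (c : ℚ) (q : Fin 10 → ℚ) (S : Finset (ZMod 11)ˣ) :
    ∏ a ∈ S, embed (c • q) (a : ZMod 11) = (c : ℂ) ^ S.card * ∏ a ∈ S, embed q (a : ZMod 11) := by
  simp only [embed_smul, Finset.prod_mul_distrib, Finset.prod_const]

/-- Partial norms of a non-zero `λ` are non-zero. [folklore] -/
theorem prod_embed_ne_zero {q : Fin 10 → ℚ} (hq : q ≠ 0) (S : Finset (ZMod 11)ˣ) :
    ∏ a ∈ S, embed q (a : ZMod 11) ≠ 0 :=
  Finset.prod_ne_zero_iff.2 fun a _ h => hq ((embed_eq_zero_iff q a).1 h)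

/-- Non-empty partial norms of `0` vanish. [folklore] -/
theorem prod_embed_zero (S : Finset (ZMod 11)ˣ) (hS : S.Nonempty) :
    ∏ a ∈ S, embed (0 : Fin 10 → ℚ) (a : ZMod 11) = 0 := by
  obtain ⟨a, ha⟩ := hS
  exact Finset.prod_eq_zero ha ((embed_eq_zero_iff 0 a).2 rfl)

/-- `□ ≠ ∅`. [folklore] -/
theorem squares11_nonempty : squares11.Nonempty := ⟨1, one_mem_squares11⟩

/-- **(F8 iii) The purity design is impossible with TWO terms**: `¬ GaussPeriodDesign 2`. If the levels
differ (`n₀ ≠ n₁`), the `k = 0, 1` conditions on the bad singleton `{1}` kill each term separately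
(`s_t σ₁(λ_t) = 0`), so the `□`-sum vanishes; if `n₀ = n₁`, degenerate terms again kill the `□`-sum, and
otherwise the singleton condition gives `λ₁ = c λ₀`, `c = -s₀/s₁ ∈ ℚ` (injectivity of `σ₁`), the bad pair
`{1, 2}` gives `s₀ + s₁ c² = 0` next to `s₀ + s₁ c = 0`, whence `c = 1`, `s₀ = -s₁`, and the `□`-sum is
`(s₀ + s₁) N_□(λ₀) = 0`. So a purity design needs `r ≥ 3` terms. [folklore] -/
theorem not_gaussPeriodDesign_two : ¬ GaussPeriodDesign 2 := by
  rintro ⟨s, n, q, hbad, hgood⟩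
  simp only [Fin.sum_univ_two] at hgood
  -- the bad sets {1} and {1, u2}
  have hb1 := bad_of (S := {1}) (by simp) (by simp [u3_ne_one]) (by simp)
  have hb2 := bad_of (S := {1, u2}) (by simp) (by simp [u3_ne_one, u3_ne_u2]) (by
    rw [Finset.card_pair u2_ne_one.symm])
  -- notation for the four numbers
  have inj1 : ∀ q' : Fin 10 → ℚ, embed q' (1 : ZMod 11) = 0 ↔ q' = 0 := fun q' => by
    simpa using embed_eq_zero_iff q' 1
  set N0 : ℂ := embed (q 0) (1 : ZMod 11) with hN0
  set N1 : ℂ := embed (q 1) (1 : ZMod 11) with hN1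
  -- a term with `s_t = 0` or `q_t = 0` contributes nothing to the □-sum
  have vanish : ∀ t : Fin 2, ((s t : ℂ) = 0 ∨ q t = 0) →
      (s t : ℂ) * ∏ a ∈ squares11, embed (q t) (a : ZMod 11) = 0 := by
    rintro t (h | h)
    · rw [h, zero_mul]
    · rw [h, prod_embed_zero _ squares11_nonempty, mul_zero]
  -- singleton conditions, k = 0 and k = 1
  have e0 := hbad {1} hb1.1 hb1.2.1 hb1.2.2.1 hb1.2.2.2 0 (by simp)
  have e1 := hbad {1} hb1.1 hb1.2.1 hb1.2.2.1 hb1.2.2.2 1 (by simp)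
  simp only [Fin.sum_univ_two, Finset.prod_singleton, Units.val_one, pow_zero, mul_one, pow_one] at e0 e1
  rw [← hN0, ← hN1] at e0 e1
  by_cases hn : (n 0 : ℂ) = n 1
  · -- equal levels: only k = 0 matters
    -- if one of the terms is degenerate, the □-sum vanishes
    by_cases hs0 : (s 0 : ℂ) = 0
    · have : (s 1 : ℂ) * N1 = 0 := by rw [hs0, zero_mul, zero_add] at e0; exact e0
      rcases mul_eq_zero.1 this with h | h
      · exact hgood (by rw [vanish 0 (Or.inl hs0), vanish 1 (Or.inl h), add_zero])
      · exact hgood (by rw [vanish 0 (Or.inl hs0), vanish 1 (Or.inr ((inj1 _).1 h)), add_zero])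
    by_cases hs1 : (s 1 : ℂ) = 0
    · have : (s 0 : ℂ) * N0 = 0 := by rw [hs1, zero_mul, add_zero] at e0; exact e0
      rcases mul_eq_zero.1 this with h | h
      · exact hs0 h
      · exact hgood (by rw [vanish 1 (Or.inl hs1), vanish 0 (Or.inr ((inj1 _).1 h)), add_zero])
    by_cases hq0 : q 0 = 0
    · have : (s 1 : ℂ) * N1 = 0 := by
        rw [hN0, hq0, (inj1 0).2 rfl, mul_zero, zero_add] at e0; exact e0
      rcases mul_eq_zero.1 this with h | h
      · exact hs1 h
      · exact hgood (by rw [vanish 0 (Or.inr hq0), vanish 1 (Or.inr ((inj1 _).1 h)), add_zero])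
    by_cases hq1 : q 1 = 0
    · have : (s 0 : ℂ) * N0 = 0 := by
        rw [hN1, hq1, (inj1 0).2 rfl, mul_zero, add_zero] at e0; exact e0
      rcases mul_eq_zero.1 this with h | h
      · exact hs0 h
      · exact hq0 ((inj1 _).1 h)
    -- main case: λ₁ = c λ₀ with c = -s₀/s₁ ∈ ℚ
    set c : ℚ := -(s 0 : ℚ) / (s 1 : ℚ) with hc
    have hs1Q : (s 1 : ℚ) ≠ 0 := by exact_mod_cast (show (s 1 : ℤ) ≠ 0 from fun h => hs1 (by simp [h]))
    have hcC : (c : ℂ) = -(s 0 : ℂ) / (s 1 : ℂ) := by rw [hc]; push_cast; ring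
    have hq1c : q 1 = c • q 0 := by
      have h0 : embed (q 1 - c • q 0) (1 : ZMod 11) = 0 := by
        rw [embed_sub, embed_smul, ← hN0, ← hN1, hcC]
        field_simp
        linear_combination e0
      have := (inj1 _).1 h0
      exact sub_eq_zero.1 this
    -- pair condition at k = 0
    have e2 := hbad {1, u2} hb2.1 hb2.2.1 hb2.2.2.1 hb2.2.2.2 0 (by rw [Finset.card_pair u2_ne_one.symm]; norm_num)
    simp only [Fin.sum_univ_two, pow_zero, mul_one] at e2
    rw [hq1c, prod_embed_smul, Finset.card_pair u2_ne_one.symm] at e2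
    have hP : ∏ a ∈ ({1, u2} : Finset (ZMod 11)ˣ), embed (q 0) (a : ZMod 11) ≠ 0 := prod_embed_ne_zero hq0 _
    have e2' : (s 0 : ℂ) + (s 1 : ℂ) * (c : ℂ) ^ 2 = 0 := by
      have : ((s 0 : ℂ) + (s 1 : ℂ) * (c : ℂ) ^ 2) * ∏ a ∈ ({1, u2} : Finset (ZMod 11)ˣ), embed (q 0) (a : ZMod 11) = 0 := by
        linear_combination e2
      exact (mul_eq_zero.1 this).resolve_right hP
    -- singleton condition rewritten: s₀ + s₁ c = 0
    have e0' : (s 0 : ℂ) + (s 1 : ℂ) * (c : ℂ) = 0 := by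
      rw [hcC]; field_simp; ring
    -- hence c² = c, so c = 1 (c = 0 would make q 1 = 0)
    have hcc : (c : ℂ) * ((c : ℂ) - 1) = 0 := by
      have : (s 1 : ℂ) * ((c : ℂ) ^ 2 - (c : ℂ)) = 0 := by linear_combination e2' - e0'
      have h2 := (mul_eq_zero.1 this).resolve_left hs1
      linear_combination h2
    rcases mul_eq_zero.1 hcc with h | h
    · have : c = 0 := by exact_mod_cast h
      exact hq1 (by rw [hq1c, this, zero_smul])
    · have hc1 : (c : ℂ) = 1 := by linear_combination h
      have hc1Q : c = 1 := by exact_mod_cast hc1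
      apply hgood
      rw [hq1c, hc1Q, one_smul]
      have : (s 0 : ℂ) + (s 1 : ℂ) = 0 := by rw [hc1] at e0'; simpa using e0'
      linear_combination (∏ a ∈ squares11, embed (q 0) (a : ZMod 11)) * this
  · -- distinct levels: each term is killed separately
    have k0 : (s 0 : ℂ) * N0 * ((n 1 : ℂ) - n 0) = 0 := by linear_combination (n 1 : ℂ) * e0 - e1
    have k1 : (s 1 : ℂ) * N1 * ((n 0 : ℂ) - n 1) = 0 := by linear_combination (n 0 : ℂ) * e0 - e1
    have hn' : (n 1 : ℂ) - n 0 ≠ 0 := sub_ne_zero.2 (Ne.symm hn)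
    have hn'' : (n 0 : ℂ) - n 1 ≠ 0 := sub_ne_zero.2 hn
    have t0 := (mul_eq_zero.1 k0).resolve_right hn'
    have t1 := (mul_eq_zero.1 k1).resolve_right hn''
    apply hgood
    have v0 : (s 0 : ℂ) * ∏ a ∈ squares11, embed (q 0) (a : ZMod 11) = 0 := by
      rcases mul_eq_zero.1 t0 with h | h
      · exact vanish 0 (Or.inl h)
      · exact vanish 0 (Or.inr ((inj1 _).1 h))
    have v1 : (s 1 : ℂ) * ∏ a ∈ squares11, embed (q 1) (a : ZMod 11) = 0 := by
      rcases mul_eq_zero.1 t1 with h | h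
      · exact vanish 1 (Or.inl h)
      · exact vanish 1 (Or.inr ((inj1 _).1 h))
    rw [v0, v1, add_zero]

end AnchorTyping

/-! ## §D Targets (cycle 3): the six registered stubs of the PICKED line `generic-ppav-secant-descent`

Skeleton `Lines/generic-ppav-secant-descent.lean` (sha 7545e3bc, lead `prover-line-stmt-HodgeConjecture-1262-0`,
registered 2026-08-16T02:54:35Z); `stuck_stubs = []` at this cycle. The skeleton cannot be imported (it carries
`sorry`s), so each stub is restated VERBATIM here (`Stub…`), the `type_of%` chain rendered as an implication
from the previous `Stub…`. Findings: S1 = anchor ∧ VHC-instance (HC-implied given an anchor); S2 = `HWA(11,6)`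
on hyperbolic members (HC- and ladder-implied); S6 ⟸ crux; S3 needs both its signature and sign hypotheses (§I);
S4/S5 untyped-able here (construction / Künneth). No stub is refutable short of `¬HC` (F1). -/

section Targets


open CategoryTheory Complex
open Literature.AlgebraicGeometry Literature.AlgebraicGeometry.Motives
  Literature.AlgebraicGeometry.HodgeTheory Literature.AlgebraicTopology.SingularHomology
open Summit.HodgeConjecture.HodgeConjecture.Theses.HeckePrymWeil
open Summit.HodgeConjecture.HodgeConjecture.Theorems.WeilTenfoldsSqrtMinus11.Negative

/-! ### S1 `stub_secantSpread` = (anchor EXISTS) ∧ (variational Hodge through it) -/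

/-- The ANCHOR block of `stub_secantSpread` (its eleven existential conjuncts), for given data:
a split (`e₀`), `K`-compatibly polarised (`h₀` rational, `N¹`, `ψ₀^* h₀ = 11 h₀`, `Q_{h₀}`
non-degenerate, Kähler), hyperbolic `ℚ(√-11)`-twelvefold. [folklore] -/
def SecantAnchor (A₀ : AbelianVariety ℂ) (ψ₀ e₀ : A₀ ⟶ A₀) (h₀ : complexBetti A₀.X 2) : Prop :=
  A₀.dim = 12 ∧ ψ₀ ≫ ψ₀ = -((11 : ℤ) • 𝟙 A₀) ∧
    e₀ ≫ e₀ = e₀ ∧ e₀ ≫ ψ₀ ≫ e₀ = 0 ∧ (𝟙 A₀ - e₀) ≫ ψ₀ ≫ (𝟙 A₀ - e₀) = 0 ∧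
    IsRationalClass h₀ ∧ h₀ ∈ algebraicClasses A₀.X 1 ∧
    complexBetti.map ψ₀.hom.hom.hom 2 h₀ = (11 : ℂ) • h₀ ∧
    (∀ x : complexBetti A₀.X 1,
      (∀ y : complexBetti A₀.X 1, polarizationPairingOne A₀.X h₀ 11 x y = 0) → x = 0) ∧
    IsKaehlerClass 12 A₀.X h₀ ∧ IsHyperbolicWeilType A₀ ψ₀ 6 h₀

/-- The VARIATIONAL block of `stub_secantSpread` for given `(A₀, ψ₀, h₀)`: along every smooth
projective family of twelvefolds over a smooth integral quasi-projective base with a fibre identified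
with `A₀`, every flat family `w` of rational `(6,6)` classes starting in the Weil plane of
`(A₀, ψ₀)` (next to a flat Hodge family `hh` starting at `h₀`) is algebraic on every fibre. [folklore] -/
def SecantSpreadFrom (A₀ : AbelianVariety ℂ) (ψ₀ : A₀ ⟶ A₀) (h₀ : complexBetti A₀.X 2) : Prop :=
  ∀ (𝒳 S : SchemeOver ℂ) (π : 𝒳 ⟶ S),
    IsSmoothProjectiveFamily π 12 → IsQuasiProjectiveOver S →
    _root_.AlgebraicGeometry.IsIntegral S.left → _root_.AlgebraicGeometry.Smooth S.hom →
  ∀ (hh : ∀ s : ComplexPoints S, complexBetti (fiberOver π s) (2 * 1))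
    (w : ∀ s : ComplexPoints S, complexBetti (fiberOver π s) (2 * 6)),
    Continuous (fun s => (⟨s, hh s⟩ : FiberClass π (2 * 1))) →
    Continuous (fun s => (⟨s, w s⟩ : FiberClass π (2 * 6))) →
    (∀ s, (⟨s, hh s⟩ : FiberClass π (2 * 1)) ∈ locusOfHodgeClasses π 12 1) →
    (∀ s, (⟨s, w s⟩ : FiberClass π (2 * 6)) ∈ locusOfHodgeClasses π 12 6) →
  ∀ (s₀ : ComplexPoints S) (ι₀ : fiberOver π s₀ ≅ A₀.X) (c₀ : complexBetti A₀.X 12),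
    c₀ ∈ Module.End.eigenspace (complexBetti.map (𝟙 A₀ + ψ₀).hom.hom.hom 12).hom
            ((1 + Complex.I * (Real.sqrt (11 : ℝ) : ℂ)) ^ 12) ⊔
          Module.End.eigenspace (complexBetti.map (𝟙 A₀ + ψ₀).hom.hom.hom 12).hom
            ((1 - Complex.I * (Real.sqrt (11 : ℝ) : ℂ)) ^ 12) →
    hh s₀ = complexBetti.map ι₀.hom (2 * 1) h₀ →
    w s₀ = complexBetti.map ι₀.hom (2 * 6) c₀ →
  ∀ s : ComplexPoints S, w s ∈ algebraicClasses (fiberOver π s) 6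

/-- VERBATIM copy of the statement of `stub_secantSpread` (skeleton sha 7545e3bc, registered
2026-08-16T02:54:35Z). [folklore] -/
def StubSecantSpread : Prop :=
    ∃ (A₀ : AbelianVariety ℂ) (ψ₀ e₀ : A₀ ⟶ A₀) (h₀ : complexBetti A₀.X 2),
      A₀.dim = 12 ∧ ψ₀ ≫ ψ₀ = -((11 : ℤ) • 𝟙 A₀) ∧
      e₀ ≫ e₀ = e₀ ∧ e₀ ≫ ψ₀ ≫ e₀ = 0 ∧ (𝟙 A₀ - e₀) ≫ ψ₀ ≫ (𝟙 A₀ - e₀) = 0 ∧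
      IsRationalClass h₀ ∧ h₀ ∈ algebraicClasses A₀.X 1 ∧
      complexBetti.map ψ₀.hom.hom.hom 2 h₀ = (11 : ℂ) • h₀ ∧
      (∀ x : complexBetti A₀.X 1,
        (∀ y : complexBetti A₀.X 1, polarizationPairingOne A₀.X h₀ 11 x y = 0) → x = 0) ∧
      IsKaehlerClass 12 A₀.X h₀ ∧ IsHyperbolicWeilType A₀ ψ₀ 6 h₀ ∧
      ∀ (𝒳 S : SchemeOver ℂ) (π : 𝒳 ⟶ S),
        IsSmoothProjectiveFamily π 12 → IsQuasiProjectiveOver S →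
        _root_.AlgebraicGeometry.IsIntegral S.left → _root_.AlgebraicGeometry.Smooth S.hom →
      ∀ (hh : ∀ s : ComplexPoints S, complexBetti (fiberOver π s) (2 * 1))
        (w : ∀ s : ComplexPoints S, complexBetti (fiberOver π s) (2 * 6)),
        Continuous (fun s => (⟨s, hh s⟩ : FiberClass π (2 * 1))) →
        Continuous (fun s => (⟨s, w s⟩ : FiberClass π (2 * 6))) →
        (∀ s, (⟨s, hh s⟩ : FiberClass π (2 * 1)) ∈ locusOfHodgeClasses π 12 1) →
        (∀ s, (⟨s, w s⟩ : FiberClass π (2 * 6)) ∈ locusOfHodgeClasses π 12 6) →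
      ∀ (s₀ : ComplexPoints S) (ι₀ : fiberOver π s₀ ≅ A₀.X) (c₀ : complexBetti A₀.X 12),
        c₀ ∈ Module.End.eigenspace (complexBetti.map (𝟙 A₀ + ψ₀).hom.hom.hom 12).hom
                ((1 + Complex.I * (Real.sqrt (11 : ℝ) : ℂ)) ^ 12) ⊔
              Module.End.eigenspace (complexBetti.map (𝟙 A₀ + ψ₀).hom.hom.hom 12).hom
                ((1 - Complex.I * (Real.sqrt (11 : ℝ) : ℂ)) ^ 12) →
        hh s₀ = complexBetti.map ι₀.hom (2 * 1) h₀ →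
        w s₀ = complexBetti.map ι₀.hom (2 * 6) c₀ →
      ∀ s : ComplexPoints S, w s ∈ algebraicClasses (fiberOver π s) 6

/-- Read-back: `stub_secantSpread` = "an anchor EXISTS, and Weil classes spread from it". [folklore] -/
theorem stubSecantSpread_iff :
    StubSecantSpread ↔ ∃ (A₀ : AbelianVariety ℂ) (ψ₀ e₀ : A₀ ⟶ A₀) (h₀ : complexBetti A₀.X 2),
      SecantAnchor A₀ ψ₀ e₀ h₀ ∧ SecantSpreadFrom A₀ ψ₀ h₀ := by
  simp only [StubSecantSpread, SecantAnchor, SecantSpreadFrom, and_assoc]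

/-- **The variational block is a consequence of the summit, for ARBITRARY anchor data** (no
`ψ₀`, no `e₀`, no polarisation, no Weil plane needed): `w s` is a rational `(6,6)` class on the
smooth projective twelvefold `𝒳_s` (`IsSmoothProjectiveFamily.isSmoothProjective`), so the Hodge
conjecture makes it algebraic. Hence `stub_secantSpread` is irrefutable short of `¬HC` once an anchor
exists (next theorem). [cite: Deligne2000, §1] -/
theorem secantSpreadFrom_of_hodgeConjecture (hHC : _root_.HodgeConjecture) (A₀ : AbelianVariety ℂ)
    (ψ₀ : A₀ ⟶ A₀) (h₀ : complexBetti A₀.X 2) : SecantSpreadFrom A₀ ψ₀ h₀ := by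
  intro 𝒳 S π hπ _ _ _ hh w _ _ _ hw s₀ ι₀ c₀ _ _ _ s
  exact (hHC (hπ.isSmoothProjective s)).2 6 (w s) (hw s).1 (hw s).2

/-- **Under HC, `stub_secantSpread` is EQUIVALENT to the bare existence of an anchor** (a split,
`K`-compatibly polarised, hyperbolic `ℚ(√-11)`-twelvefold — classically Markman's `X × X̂`,
arXiv:2502.03415 Lemma 3.1.3, or `E⁶ × E⁶`; not constructible in the tree today, F2). So the only
refutation route for S1 is `¬HC` (or the absurd "no anchor exists"). [cite: Deligne2000, §1] -/
theorem stubSecantSpread_iff_exists_anchor_of_hodgeConjecture (hHC : _root_.HodgeConjecture) :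
    StubSecantSpread ↔ ∃ (A₀ : AbelianVariety ℂ) (ψ₀ e₀ : A₀ ⟶ A₀) (h₀ : complexBetti A₀.X 2),
      SecantAnchor A₀ ψ₀ e₀ h₀ := by
  rw [stubSecantSpread_iff]
  exact ⟨fun ⟨A₀, ψ₀, e₀, h₀, hA, _⟩ => ⟨A₀, ψ₀, e₀, h₀, hA⟩,
    fun ⟨A₀, ψ₀, e₀, h₀, hA⟩ => ⟨A₀, ψ₀, e₀, h₀, hA, secantSpreadFrom_of_hodgeConjecture hHC A₀ ψ₀ h₀⟩⟩

/-- Shape of a refutation of S1: given ANY anchor, `¬ stub_secantSpread → ¬ HC`. [cite: Deligne2000, §1] -/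
theorem not_hodgeConjecture_of_anchor_of_not_stubSecantSpread
    (hA : ∃ (A₀ : AbelianVariety ℂ) (ψ₀ e₀ : A₀ ⟶ A₀) (h₀ : complexBetti A₀.X 2), SecantAnchor A₀ ψ₀ e₀ h₀)
    (h : ¬ StubSecantSpread) : ¬ _root_.HodgeConjecture := fun hHC =>
  h ((stubSecantSpread_iff_exists_anchor_of_hodgeConjecture hHC).2 hA)

/-- Conversely S1 hands out its anchor (trivial projection; recorded so that S2/S4 consumers see what the
`∃` really provides). [folklore] -/
theorem exists_anchor_of_stubSecantSpread (h : StubSecantSpread) :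
    ∃ (A₀ : AbelianVariety ℂ) (ψ₀ e₀ : A₀ ⟶ A₀) (h₀ : complexBetti A₀.X 2), SecantAnchor A₀ ψ₀ e₀ h₀ := by
  obtain ⟨A₀, ψ₀, e₀, h₀, hA, _⟩ := stubSecantSpread_iff.1 h
  exact ⟨A₀, ψ₀, e₀, h₀, hA⟩

/-! #### The endomorphism half of the anchor block is already constructible (any square `X × X`) -/

/-- **The endomorphism half of the anchor block is satisfiable on EVERY square `X × X`**: the
off-diagonal `ψ₀ = (0, -11; 1, 0)` (`(x, y) ↦ (-11y, x)`) has `ψ₀ ≫ ψ₀ = -11`, and `e₀ = pr₁`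
(`(x, y) ↦ (x, 0)`) is an idempotent with `e₀ψ₀e₀ = 0 = (𝟙 - e₀)ψ₀(𝟙 - e₀)` — pure algebra in the
preadditive category `AbelianVariety ℂ` with its products (`prodLift`, `fst`, `snd`). For Markman's
anchor take `X` a principally polarised sixfold and read the second factor as `X̂ ≅ X`. [folklore] -/
theorem exists_offDiagonal_on_square (X : AbelianVariety ℂ) :
    ∃ (ψ₀ e₀ : X.prod X ⟶ X.prod X), ψ₀ ≫ ψ₀ = -((11 : ℤ) • 𝟙 (X.prod X)) ∧
      e₀ ≫ e₀ = e₀ ∧ e₀ ≫ ψ₀ ≫ e₀ = 0 ∧ (𝟙 (X.prod X) - e₀) ≫ ψ₀ ≫ (𝟙 (X.prod X) - e₀) = 0 := by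
  let F : X.prod X ⟶ X := AbelianVariety.fst X X
  let S : X.prod X ⟶ X := AbelianVariety.snd X X
  let ψ₀ : X.prod X ⟶ X.prod X := AbelianVariety.prodLift (-((11 : ℤ) • S)) F
  let e₀ : X.prod X ⟶ X.prod X := AbelianVariety.prodLift F 0
  have hψF : ψ₀ ≫ F = -((11 : ℤ) • S) := AbelianVariety.prodLift_fst _ _
  have hψS : ψ₀ ≫ S = F := AbelianVariety.prodLift_snd _ _
  have heF : e₀ ≫ F = F := AbelianVariety.prodLift_fst _ _
  have heS : e₀ ≫ S = 0 := AbelianVariety.prodLift_snd _ _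
  refine ⟨ψ₀, e₀, ?_, ?_, ?_, ?_⟩
  · apply AbelianVariety.prod_hom_ext
    · change (ψ₀ ≫ ψ₀) ≫ F = _ ≫ F
      rw [Category.assoc, hψF, Preadditive.comp_neg, Preadditive.comp_zsmul, hψS,
        Preadditive.neg_comp, Preadditive.zsmul_comp, Category.id_comp]
    · change (ψ₀ ≫ ψ₀) ≫ S = _ ≫ S
      rw [Category.assoc, hψS, hψF, Preadditive.neg_comp, Preadditive.zsmul_comp, Category.id_comp]
  · apply AbelianVariety.prod_hom_ext
    · change (e₀ ≫ e₀) ≫ F = e₀ ≫ F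
      rw [Category.assoc, heF, heF]
    · change (e₀ ≫ e₀) ≫ S = e₀ ≫ S
      rw [Category.assoc, heS, Limits.comp_zero]
  · apply AbelianVariety.prod_hom_ext
    · change (e₀ ≫ ψ₀ ≫ e₀) ≫ F = (0 : X.prod X ⟶ X.prod X) ≫ F
      rw [Category.assoc, Category.assoc, heF, hψF, Preadditive.comp_neg, Preadditive.comp_zsmul, heS,
        smul_zero, neg_zero, Limits.zero_comp]
    · change (e₀ ≫ ψ₀ ≫ e₀) ≫ S = (0 : X.prod X ⟶ X.prod X) ≫ S
      rw [Category.assoc, Category.assoc, heS, Limits.comp_zero, Limits.comp_zero, Limits.zero_comp]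
  · have h1F : (𝟙 (X.prod X) - e₀) ≫ F = 0 := by
      rw [Preadditive.sub_comp, Category.id_comp, heF, sub_self]
    have h1S : (𝟙 (X.prod X) - e₀) ≫ S = S := by
      rw [Preadditive.sub_comp, Category.id_comp, heS, sub_zero]
    apply AbelianVariety.prod_hom_ext
    · change ((𝟙 (X.prod X) - e₀) ≫ ψ₀ ≫ (𝟙 (X.prod X) - e₀)) ≫ F = (0 : X.prod X ⟶ X.prod X) ≫ F
      rw [Category.assoc, Category.assoc, h1F, Limits.comp_zero, Limits.comp_zero, Limits.zero_comp]
    · change ((𝟙 (X.prod X) - e₀) ≫ ψ₀ ≫ (𝟙 (X.prod X) - e₀)) ≫ S = (0 : X.prod X ⟶ X.prod X) ≫ S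
      rw [Category.assoc, Category.assoc, h1S, hψS, h1F, Limits.zero_comp]

/-- **Given ANY abelian sixfold, the first five conjuncts of S1's anchor block are witnessed in the
tree** (`A₀ = X × X`, `dim_prod`): the F2 obstruction to writing down an anchor is purely
cohomological (`h₀`: rationality, `N¹`, `ψ₀^* h₀ = 11 h₀`, non-degeneracy, Kähler, the hyperbolic
12-frame — all need Künneth for `complexBetti`). [folklore] -/
theorem exists_twelvefold_offDiagonal_of_sixfold (X : AbelianVariety ℂ) (hX : X.dim = 6) :
    ∃ (A₀ : AbelianVariety ℂ) (ψ₀ e₀ : A₀ ⟶ A₀), A₀.dim = 12 ∧ ψ₀ ≫ ψ₀ = -((11 : ℤ) • 𝟙 A₀) ∧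
      e₀ ≫ e₀ = e₀ ∧ e₀ ≫ ψ₀ ≫ e₀ = 0 ∧ (𝟙 A₀ - e₀) ≫ ψ₀ ≫ (𝟙 A₀ - e₀) = 0 := by
  obtain ⟨ψ₀, e₀, h1, h2, h3, h4⟩ := exists_offDiagonal_on_square X
  exact ⟨X.prod X, ψ₀, e₀, by rw [AbelianVariety.dim_prod, hX], h1, h2, h3, h4⟩

/-! ### S2 `stub_moduliReach`: its conclusion is `HWA(11, 6)` restricted to hyperbolic polarised twelvefolds -/

/-- The conclusion block of `stub_moduliReach` (VERBATIM, without the leading `type_of% stub_secantSpread →`):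
Hodge–Weil classes on HYPERBOLIC, `K`-compatibly (Kähler-)polarised `ℚ(√-11)`-twelvefolds. [folklore] -/
def StubModuliReachCore : Prop :=
    ∀ (X : AbelianVariety ℂ) (ψ : X ⟶ X), X.dim = 12 → ψ ≫ ψ = -((11 : ℤ) • 𝟙 X) →
    ∀ h : complexBetti X.X 2, IsRationalClass h → h ∈ algebraicClasses X.X 1 →
      complexBetti.map ψ.hom.hom.hom 2 h = (11 : ℂ) • h →
      (∀ x : complexBetti X.X 1,
        (∀ y : complexBetti X.X 1, polarizationPairingOne X.X h 11 x y = 0) → x = 0) →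
      IsKaehlerClass 12 X.X h → IsHyperbolicWeilType X ψ 6 h →
    ∀ c : complexBetti X.X 12, IsRationalClass c → IsOfHodgeType 12 X.X 12 6 6 c →
      c ∈ Module.End.eigenspace (complexBetti.map (𝟙 X + ψ).hom.hom.hom 12).hom
            ((1 + Complex.I * (Real.sqrt (11 : ℝ) : ℂ)) ^ 12) ⊔
          Module.End.eigenspace (complexBetti.map (𝟙 X + ψ).hom.hom.hom 12).hom
            ((1 - Complex.I * (Real.sqrt (11 : ℝ) : ℂ)) ^ 12) →
      c ∈ algebraicClasses X.X 6

/-- VERBATIM shape of `stub_moduliReach` (`type_of% stub_secantSpread → …`). [folklore] -/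
def StubModuliReach : Prop := StubSecantSpread → StubModuliReachCore

/-- The rung predicate `HWA(11, m)` of the route in dimension `2m`, typed verbatim as in
`HodgeWeilLadder` / `WeilDescending` / `Negative.KillPropagation` (casts `((11:ℕ):ℤ)`, `√((11:ℕ):ℝ)`). [folklore] -/
def HWA11 (m : ℕ) : Prop :=
  ∀ (A : AbelianVariety ℂ) (φ : A ⟶ A), A.dim = (2 * m) →
    φ ≫ φ = -((((11 : ℕ) : ℤ)) • 𝟙 A) →
    ∀ c : complexBetti A.X (2 * m), IsRationalClass c → IsOfHodgeType (2 * m) A.X (2 * m) m m c →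
      c ∈ Module.End.eigenspace (complexBetti.map (𝟙 A + φ).hom.hom.hom (2 * m)).hom
            ((1 + Complex.I * (Real.sqrt ((11 : ℕ) : ℝ) : ℂ)) ^ (2 * m)) ⊔
          Module.End.eigenspace (complexBetti.map (𝟙 A + φ).hom.hom.hom (2 * m)).hom
            ((1 - Complex.I * (Real.sqrt ((11 : ℕ) : ℝ) : ℂ)) ^ (2 * m)) →
      c ∈ algebraicClasses A.X m

/-- **S2's conclusion is the twelvefold rung `HWA(11, 6)` RESTRICTED to hyperbolic polarised members**:
`HWA(11,6) → StubModuliReachCore` (the six polarisation/hyperbolicity hypotheses are simply dropped).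
NB `6 ∉ 5ℕ`: dimension 12 is NOT a Hecke–Prym rung `(11, g')` (`n = 5(g'-1)`); in the route it is
reached only from rung `(11, 3)` (`n = 10`) by four descents. [folklore] -/
theorem stubModuliReachCore_of_hwa11_six (h6 : HWA11 6) : StubModuliReachCore := by
  intro X ψ hdim hψ h _ _ _ _ _ _ c hrat hhodge hweil
  have h' := h6 X ψ hdim (by simpa using hψ) c hrat hhodge
  simpa using h' (by simpa using hweil)

/-- … hence a consequence of the summit (F1 one rung up). [cite: Deligne2000, §1] -/
theorem stubModuliReachCore_of_hodgeConjecture (hHC : _root_.HodgeConjecture) : StubModuliReachCore := by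
  intro X ψ hdim _ h _ _ _ _ _ _ c hrat hhodge _
  have hsp : IsSmoothProjective 12 X.X := hdim ▸ (AbelianVariety.isSmoothProjective_holds (A := X))
  exact (hHC hsp).2 6 c hrat hhodge

/-- … and of the route's own target + descending lemma: `HodgeWeilLadder → WeilDescending → HWA(11,6)`
(rung `(11,3)` is `HWA(11,10)`; descend `10 → 6`). [folklore] -/
theorem hwa11_six_of_ladder (hL : HodgeWeilLadder) (hD : WeilDescending) : HWA11 6 :=
  descend_logic _ (hD 11 (by norm_num) (by norm_num) (by norm_num)) (by norm_num) (by norm_num : 6 ≤ 10)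
    (rung11_of_hodgeWeilLadder hL (g := 3) (by norm_num) 10 (by norm_num))

/-- Shape of a refutation of S2's conclusion: it refutes `HWA(11,6)`, the target (with Descending) and HC —
never the crux directly (the crux is `HWA(11,5)`; `6 → 5` descends, `5 → 6` does not). [folklore] -/
theorem not_hwa11_six_of_not_stubModuliReachCore (h : ¬ StubModuliReachCore) : ¬ HWA11 6 :=
  fun h6 => h (stubModuliReachCore_of_hwa11_six h6)

/-! ### S6 `stub_descent`: implied by the crux itself -/

/-- The conclusion block of `stub_descent` (VERBATIM, without the leading `type_of% stub_hodgeTypeExterior →`). [folklore] -/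
def StubDescentCore : Prop :=
    ∀ (A : AbelianVariety ℂ) (φ : A ⟶ A) (B : AbelianVariety ℂ) (φB : B ⟶ B),
      A.dim = 10 → B.dim = 2 → φ ≫ φ = -((11 : ℤ) • 𝟙 A) → φB ≫ φB = -((11 : ℤ) • 𝟙 B) →
      (∃ bp bm η : complexBetti B.X 2,
        bp ∈ Module.End.eigenspace (complexBetti.map (𝟙 B + φB).hom.hom.hom 2).hom
              ((1 + Complex.I * (Real.sqrt (11 : ℝ) : ℂ)) ^ 2) ∧
        bm ∈ Module.End.eigenspace (complexBetti.map (𝟙 B + φB).hom.hom.hom 2).hom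
              ((1 - Complex.I * (Real.sqrt (11 : ℝ) : ℂ)) ^ 2) ∧
        IsRationalClass (bp + bm) ∧ IsOfHodgeType 2 B.X 2 1 1 (bp + bm) ∧
        η ∈ algebraicClasses B.X 1 ∧
        cupProduct (show 2 + 2 = 4 from rfl) bp η ≠ 0 ∧
        cupProduct (show 2 + 2 = 4 from rfl) bm η ≠ 0) →
      (∀ u : complexBetti (A.prod B).X 12, IsRationalClass u →
        IsOfHodgeType 12 (A.prod B).X 12 6 6 u →
        u ∈ Module.End.eigenspace (complexBetti.map (𝟙 (A.prod B) +
                AbelianVariety.prodLift (AbelianVariety.fst A B ≫ φ)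
                  (AbelianVariety.snd A B ≫ φB)).hom.hom.hom 12).hom
              ((1 + Complex.I * (Real.sqrt (11 : ℝ) : ℂ)) ^ 12) ⊔
            Module.End.eigenspace (complexBetti.map (𝟙 (A.prod B) +
                AbelianVariety.prodLift (AbelianVariety.fst A B ≫ φ)
                  (AbelianVariety.snd A B ≫ φB)).hom.hom.hom 12).hom
              ((1 - Complex.I * (Real.sqrt (11 : ℝ) : ℂ)) ^ 12) →
        u ∈ algebraicClasses (A.prod B).X 6) →
      ∀ c : complexBetti A.X 10, IsRationalClass c → IsOfHodgeType 10 A.X 10 5 5 c →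
        c ∈ Module.End.eigenspace (complexBetti.map (𝟙 A + φ).hom.hom.hom 10).hom
              ((1 + Complex.I * (Real.sqrt (11 : ℝ) : ℂ)) ^ 10) ⊔
            Module.End.eigenspace (complexBetti.map (𝟙 A + φ).hom.hom.hom 10).hom
              ((1 - Complex.I * (Real.sqrt (11 : ℝ) : ℂ)) ^ 10) →
        c ∈ algebraicClasses A.X 5

/-- **S6 is WEAKER than the crux**: `WeilTenfoldsSqrtMinus11 → StubDescentCore` (forget the partner
surface and the twelvefold hypothesis). So S6 can never be the obstacle: a refutation of S6 IS a
refutation of the crux (next theorem), hence of HC (F1). [folklore] -/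
theorem stubDescentCore_of_crux (h : WeilTenfoldsSqrtMinus11) : StubDescentCore :=
  fun A φ _ _ hA _ hφ _ _ _ c hrat hhodge hweil => h A φ hA hφ c hrat hhodge hweil

/-- `¬ S6 → ¬ crux`. [folklore] -/
theorem not_crux_of_not_stubDescentCore (h : ¬ StubDescentCore) : ¬ WeilTenfoldsSqrtMinus11 :=
  fun hc => h (stubDescentCore_of_crux hc)

/-! ### S6, projector step: the integers behind `q(T)` (docstring claim "`q ∈ ℤ[X]`" checked) -/

/-- `weilXY 11 2 = (-10, 2)`: `(1 + i√11)² = -10 + 2i√11`. [folklore] -/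
theorem weilXY_eleven_two : weilXY 11 2 = (-10, 2) := by decide

/-- `weilXY 11 8 = (-14464, -4480)`: `(1 + i√11)⁸ = -14464 - 4480 i√11`. [folklore] -/
theorem weilXY_eleven_eight : weilXY 11 8 = (-14464, -4480) := by decide

/-- `weilXY 11 10 = (243200, 15872)`. [folklore] -/
theorem weilXY_eleven_ten' : weilXY 11 10 = (243200, 15872) := by decide

/-- `weilXY 11 12 = (-2781184, 327680)`: `(1 + i√11)¹² = -2781184 + 327680 i√11`. [folklore] -/
theorem weilXY_eleven_twelve : weilXY 11 12 = (-2781184, 327680) := by decide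

local notation "τ" => (I * ((Real.sqrt (11 : ℝ) : ℝ) : ℂ))

theorem tau_sq : τ ^ 2 = -11 := by
  have := I_mul_sqrt_sq 11
  push_cast at this
  simpa using this

/-- `λ₊¹⁰ λ₋² = -2082816 - 645120 i√11` (a MIXED product eigenvalue on `A × B`). [folklore] -/
theorem mixed_ten_two_eq :
    (1 + τ) ^ 10 * (1 - τ) ^ 2 = -2082816 - 645120 * τ := by
  have h10 := one_add_pow_eq 11 τ (by exact_mod_cast tau_sq) 10
  have h2 := one_sub_pow_eq 11 τ (by exact_mod_cast tau_sq) 2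
  rw [weilXY_eleven_ten'] at h10
  rw [weilXY_eleven_two] at h2
  push_cast at h10 h2
  rw [h10, h2]
  linear_combination (-31744 : ℂ) * tau_sq

/-- `λ₊² λ₋¹⁰ = -2082816 + 645120 i√11`. [folklore] -/
theorem mixed_two_ten_eq :
    (1 + τ) ^ 2 * (1 - τ) ^ 10 = -2082816 + 645120 * τ := by
  have h2 := one_add_pow_eq 11 τ (by exact_mod_cast tau_sq) 2
  have h10 := one_sub_pow_eq 11 τ (by exact_mod_cast tau_sq) 10
  rw [weilXY_eleven_ten'] at h10
  rw [weilXY_eleven_two] at h2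
  push_cast at h10 h2
  rw [h10, h2]
  linear_combination (-31744 : ℂ) * tau_sq

/-- **The projector polynomial of S6 has INTEGER coefficients**: the two mixed product eigenvalues
`μ₁ = λ₊¹⁰λ₋²`, `μ₂ = λ₊²λ₋¹⁰` of `(𝟙 + φ × φ_B)^*` on `pr_A^* H¹⁰ ⌣ pr_B^* H²` have
`μ₁ + μ₂ = -4165632` and `μ₁ μ₂ = 12¹² = 8916100448256`, so
`q(X) = (X - μ₁)(X - μ₂) = X² + 4165632·X + 8916100448256 ∈ ℤ[X]` and `q(T)P`, `T q(T) P` are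
RATIONAL classes whenever `P` is (the docstring's "`q ∈ ℤ[X]`", needed for the hypothesis of S6 to
apply to `q(T)P`). [folklore] -/
theorem mixedPair_sum_eq :
    (1 + τ) ^ 10 * (1 - τ) ^ 2 + (1 + τ) ^ 2 * (1 - τ) ^ 10 = -4165632 := by
  rw [mixed_ten_two_eq, mixed_two_ten_eq]; ring

/-- `μ₁ μ₂ = 12¹²`. [folklore] -/
theorem mixedPair_mul_eq :
    ((1 + τ) ^ 10 * (1 - τ) ^ 2) * ((1 + τ) ^ 2 * (1 - τ) ^ 10) = 8916100448256 := by
  rw [mixed_ten_two_eq, mixed_two_ten_eq]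
  linear_combination (-416179814400 : ℂ) * tau_sq

/-- `q` does not vanish at the PURE eigenvalue `λ₊¹²` (so the `2×2` inversion recovers `P₊₊`):
`q(λ₊¹²) = (λ₊¹² - μ₁)(λ₊¹² - μ₂) ≠ 0`. [folklore] -/
theorem projector_ne_zero_at_plus :
    ((1 + τ) ^ 12 - (1 + τ) ^ 10 * (1 - τ) ^ 2) * ((1 + τ) ^ 12 - (1 + τ) ^ 2 * (1 - τ) ^ 10) ≠ 0 := by
  have h1 : (1 + τ) ^ 10 * (1 - τ) ^ 2 ≠ (1 + τ) ^ 12 := by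
    have := weil_mixed_ne_plus (p := 11) (by norm_num) (by norm_num) (a := 10) (b := 2) (m := 12)
      (by norm_num) (by norm_num)
    exact_mod_cast this
  have h2 : (1 + τ) ^ 2 * (1 - τ) ^ 10 ≠ (1 + τ) ^ 12 := by
    have := weil_mixed_ne_plus (p := 11) (by norm_num) (by norm_num) (a := 2) (b := 10) (m := 12)
      (by norm_num) (by norm_num)
    exact_mod_cast this
  exact mul_ne_zero (sub_ne_zero.2 (Ne.symm h1)) (sub_ne_zero.2 (Ne.symm h2))

/-- … nor at `λ₋¹²` (recovers `P₋₋`). [folklore] -/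
theorem projector_ne_zero_at_minus :
    ((1 - τ) ^ 12 - (1 + τ) ^ 10 * (1 - τ) ^ 2) * ((1 - τ) ^ 12 - (1 + τ) ^ 2 * (1 - τ) ^ 10) ≠ 0 := by
  have h1 : (1 + τ) ^ 10 * (1 - τ) ^ 2 ≠ (1 - τ) ^ 12 := by
    have := weil_mixed_ne_minus (p := 11) (by norm_num) (by norm_num) (a := 10) (b := 2) (m := 12)
      (by norm_num) (by norm_num)
    exact_mod_cast this
  have h2 : (1 + τ) ^ 2 * (1 - τ) ^ 10 ≠ (1 - τ) ^ 12 := by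
    have := weil_mixed_ne_minus (p := 11) (by norm_num) (by norm_num) (a := 2) (b := 10) (m := 12)
      (by norm_num) (by norm_num)
    exact_mod_cast this
  exact mul_ne_zero (sub_ne_zero.2 (Ne.symm h1)) (sub_ne_zero.2 (Ne.symm h2))


end Targets

/-! ## §I (cycle 3) Tightness of S3 `stub_aimingArithmetic`: both deleted-hypothesis variants are FALSE -/


open Literature.AlgebraicGeometry.Motives

section AimingTightness

variable {K : Type} [Field K] [Algebra ℚ K] {α : K}
  (hα : α * α = algebraMap ℚ K (-11))
  (hK : ∀ k : K, ∃ a b : ℚ, k = algebraMap ℚ K a + algebraMap ℚ K b * α)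

/-- `0 < 11` (the `hd` argument of the realization file at `d = 11`). -/
theorem eleven_pos : (0 : ℚ) < 11 := by norm_num

/-- The norm form `Nm z = (re z)² + 11 (im z)²` of `K = ℚ(√-11)` in the coordinates `re`, `im` of
`Motives/WeilDiscriminantRealization`. [folklore] -/
def nm (z : K) : ℚ := reCoord eleven_pos hα hK z ^ 2 + 11 * imCoord eleven_pos hα hK z ^ 2

theorem nm_nonneg (z : K) : 0 ≤ nm hα hK z := by
  unfold nm; positivity

theorem eq_zero_of_nm_eq_zero {z : K} (hz : nm hα hK z = 0) : z = 0 := by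
  unfold nm at hz
  have h1 := sq_nonneg (reCoord eleven_pos hα hK z)
  have h2 := sq_nonneg (imCoord eleven_pos hα hK z)
  have hr : reCoord eleven_pos hα hK z = 0 := by
    nlinarith
  have hi : imCoord eleven_pos hα hK z = 0 := by
    nlinarith
  rw [eq_reCoord_add_imCoord eleven_pos hα hK z, hr, hi, map_zero, zero_mul, add_zero]

/-- **`H(x, x) = E_c(x, α x) = Σ cᵢ Nm(xᵢ)`** for the diagonal Weil form on `K²` in the standard
basis: the Hermitian form of `diagWeilForm c` is `diag(c) · Nm`. [cite: vanGeemen1994HodgeAV, 5.4 (5.4.1)] -/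
theorem diagWeilForm_self_alpha (c : Fin 2 → ℚ) (x : Fin 2 → K) :
    diagWeilForm eleven_pos hα hK (Pi.basisFun K (Fin 2)) c x (α • x) =
      c 0 * nm hα hK (x 0) + c 1 * nm hα hK (x 1) := by
  rw [diagWeilForm_apply, Fin.sum_univ_two]
  have hc : ∀ i, (Pi.basisFun K (Fin 2)).coord i (α • x) = α * (Pi.basisFun K (Fin 2)).coord i x :=
    fun i => coord_alpha_smul _ i x
  have hx : ∀ i, (Pi.basisFun K (Fin 2)).coord i x = x i := fun i => by
    rw [Module.Basis.coord_apply, Pi.basisFun_repr]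
  simp only [hc, reCoord_alpha_mul, imCoord_alpha_mul, hx]
  unfold nm
  ring

/-- **S3 without its signature block is FALSE** (in every model `K` of `ℚ(√-11)`): take `n = 1`,
`V = K²` with the DEFINITE Weil form `E = E_{(1,1)}` (`H = Nm ⊕ Nm`, signature `(2,0)` — all of S3's
other hypotheses hold: alternating, Weil identity, `finrank = 2·1`) and `r₁ = r₂ = 1`. For any weights
`m₁, m₂ > 0` the summed Hermitian form `Nm ⊕ Nm ⊕ m₁Nm ⊕ (-m₂)Nm` has signature `(3,1)`, so no
`K`-plane `L ≤ K² × K²` is totally isotropic: the `K`-linear functional "last coordinate" has a non-zero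
kernel vector `x ∈ L` (`dim L = 2 > 1`), and `0 = E'(x, αx) = Nm(x₁) + Nm(x₂) + m₁ Nm(x₃)` forces
`x = 0`. Hence any proof of `stub_aimingArithmetic` must use the signature hypothesis `(P, N)`.
[folklore] -/
theorem aiming_false_without_signature :
    ¬ (∀ (V : Type) [AddCommGroup V] [Module ℚ V] [Module K V] [IsScalarTower ℚ K V]
        [Module.Finite K V] (n : ℕ), Module.finrank K V = 2 * n →
      ∀ (E : LinearMap.BilinForm ℚ V), (∀ x y : V, E x y = -E y x) →
        (∀ x y : V, E (α • x) (α • y) = 11 * E x y) →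
      ∀ r₁ r₂ : ℚ, 0 < r₁ * r₂ →
        ∃ m₁ m₂ : ℕ, 0 < m₁ ∧ 0 < m₂ ∧
          ∃ L : Submodule K (V × (Fin 2 → K)), Module.finrank K L = n + 1 ∧
            ∀ x ∈ L, ∀ y ∈ L,
              bilinOrthSum E
                (diagWeilForm (d := 11) (by norm_num) hα hK (Pi.basisFun K (Fin 2))
                  ![(m₁ : ℚ) * r₁, -((m₂ : ℚ) * r₂)]) x y = 0) := by
  intro h
  have hE1 : ∀ x y : Fin 2 → K, diagWeilForm eleven_pos hα hK (Pi.basisFun K (Fin 2)) ![1, 1] x y =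
      -diagWeilForm eleven_pos hα hK (Pi.basisFun K (Fin 2)) ![1, 1] y x :=
    fun x y => by rw [diagWeilForm_swap _ _ _ _ _ y x]
  have hE2 : ∀ x y : Fin 2 → K,
      diagWeilForm eleven_pos hα hK (Pi.basisFun K (Fin 2)) ![1, 1] (α • x) (α • y) =
        11 * diagWeilForm eleven_pos hα hK (Pi.basisFun K (Fin 2)) ![1, 1] x y :=
    fun x y => diagWeilForm_smul_smul _ _ _ _ _ x y
  obtain ⟨m₁, m₂, hm₁, _, L, hL, hiso⟩ :=
    h (Fin 2 → K) 1 (by simp) _ hE1 hE2 1 1 (by norm_num)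
  -- a non-zero vector of `L` with vanishing last coordinate
  let f : L →ₗ[K] K :=
    ((LinearMap.proj 1 : (Fin 2 → K) →ₗ[K] K).comp (LinearMap.snd K (Fin 2 → K) (Fin 2 → K))).comp
      L.subtype
  have hker : LinearMap.ker f ≠ ⊥ :=
    LinearMap.ker_ne_bot_of_finrank_lt (by rw [hL, Module.finrank_self]; norm_num)
  obtain ⟨x, hx, hx0⟩ := Submodule.exists_mem_ne_zero_of_ne_bot hker
  have hx4 : (x : (Fin 2 → K) × (Fin 2 → K)).2 1 = 0 := by
    simpa [f] using hx
  -- evaluate the summed form at `(x, α x)`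
  have h0 := hiso x x.2 (α • (x : (Fin 2 → K) × (Fin 2 → K))) (L.smul_mem α x.2)
  rw [bilinOrthSum_apply, Prod.smul_fst, Prod.smul_snd, diagWeilForm_self_alpha,
    diagWeilForm_self_alpha] at h0
  simp only [Matrix.cons_val_zero, Matrix.cons_val_one, one_mul] at h0
  have hx4' : nm hα hK ((x : (Fin 2 → K) × (Fin 2 → K)).2 1) = 0 := by
    rw [hx4]; unfold nm; simp
  rw [hx4', mul_zero, add_zero] at h0
  have h1 := nm_nonneg hα hK ((x : (Fin 2 → K) × (Fin 2 → K)).1 0)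
  have h2 := nm_nonneg hα hK ((x : (Fin 2 → K) × (Fin 2 → K)).1 1)
  have h3 := nm_nonneg hα hK ((x : (Fin 2 → K) × (Fin 2 → K)).2 0)
  have hm₁' : (0 : ℚ) < m₁ := by exact_mod_cast hm₁
  have e1 : nm hα hK ((x : (Fin 2 → K) × (Fin 2 → K)).1 0) = 0 := by nlinarith [mul_nonneg hm₁'.le h3]
  have e2 : nm hα hK ((x : (Fin 2 → K) × (Fin 2 → K)).1 1) = 0 := by nlinarith [mul_nonneg hm₁'.le h3]
  have e3 : nm hα hK ((x : (Fin 2 → K) × (Fin 2 → K)).2 0) = 0 := by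
    have : (m₁ : ℚ) * nm hα hK ((x : (Fin 2 → K) × (Fin 2 → K)).2 0) = 0 := by nlinarith
    exact (mul_eq_zero.1 this).resolve_left hm₁'.ne'
  apply hx0
  have hx' : (x : (Fin 2 → K) × (Fin 2 → K)) = 0 := by
    refine Prod.ext (funext fun i => ?_) (funext fun i => ?_)
    · fin_cases i
      · exact eq_zero_of_nm_eq_zero hα hK e1
      · exact eq_zero_of_nm_eq_zero hα hK e2
    · fin_cases i
      · exact eq_zero_of_nm_eq_zero hα hK e3
      · exact hx4
  exact (Submodule.coe_eq_zero (x := x)).1 hx'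

/-- `Nm z = 0 ↔ z = 0`. [folklore] -/
theorem nm_eq_zero_iff (z : K) : nm hα hK z = 0 ↔ z = 0 := by
  refine ⟨eq_zero_of_nm_eq_zero hα hK, fun h => ?_⟩
  rw [h]; unfold nm; simp

/-- `z ≠ 0 → 0 < Nm z`. [folklore] -/
theorem nm_pos {z : K} (hz : z ≠ 0) : 0 < nm hα hK z :=
  lt_of_le_of_ne (nm_nonneg hα hK z) fun h => hz ((nm_eq_zero_iff hα hK z).1 h.symm)

/-- The standard Weil plane `K²` with `E = E_{(1,-1)}` has signature `(1,1)` in the sense of S3: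
`P = K·e₀`, `N = K·e₁`. [folklore] -/
theorem signature_one_one :
    ∃ P N : Submodule K (Fin 2 → K), Module.finrank K P = 1 ∧ Module.finrank K N = 1 ∧ P ⊓ N = ⊥ ∧
      (∀ x ∈ P, x ≠ 0 → 0 < diagWeilForm eleven_pos hα hK (Pi.basisFun K (Fin 2)) ![1, -1] x (α • x)) ∧
      (∀ x ∈ N, x ≠ 0 → diagWeilForm eleven_pos hα hK (Pi.basisFun K (Fin 2)) ![1, -1] x (α • x) < 0) := by
  refine ⟨K ∙ (Pi.single 0 1), K ∙ (Pi.single 1 1), ?_, ?_, ?_, ?_, ?_⟩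
  · exact finrank_span_singleton (by simp)
  · exact finrank_span_singleton (by simp)
  · rw [Submodule.eq_bot_iff]
    intro x hx
    rw [Submodule.mem_inf, Submodule.mem_span_singleton, Submodule.mem_span_singleton] at hx
    obtain ⟨⟨a, ha⟩, ⟨b, hb⟩⟩ := hx
    have h0 : x 0 = 0 := by rw [← hb]; simp
    have h1 : x 1 = 0 := by rw [← ha]; simp
    funext i; fin_cases i <;> assumption
  · intro x hx hx0
    rw [Submodule.mem_span_singleton] at hx
    obtain ⟨a, rfl⟩ := hx
    have ha : a ≠ 0 := by rintro rfl; exact hx0 (by simp)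
    rw [diagWeilForm_self_alpha]
    simp only [Matrix.cons_val_zero, Matrix.cons_val_one, Pi.smul_apply, Pi.single_eq_same,
      Pi.single_eq_of_ne (show (1 : Fin 2) ≠ 0 by decide), smul_eq_mul, mul_one, mul_zero, one_mul]
    rw [(nm_eq_zero_iff hα hK 0).2 rfl]
    have := nm_pos hα hK ha
    linarith
  · intro x hx hx0
    rw [Submodule.mem_span_singleton] at hx
    obtain ⟨a, rfl⟩ := hx
    have ha : a ≠ 0 := by rintro rfl; exact hx0 (by simp)
    rw [diagWeilForm_self_alpha]
    simp only [Matrix.cons_val_zero, Matrix.cons_val_one, Pi.smul_apply, Pi.single_eq_same,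
      Pi.single_eq_of_ne (show (0 : Fin 2) ≠ 1 by decide), smul_eq_mul, mul_one, mul_zero, one_mul]
    rw [(nm_eq_zero_iff hα hK 0).2 rfl]
    have := nm_pos hα hK ha
    linarith

/-- **S3 without `0 < r₁ r₂` is FALSE** (in every model `K` of `ℚ(√-11)`): with ALL other hypotheses of
S3 in force (`n = 1`, `V = K²`, `E = E_{(1,-1)}` of signature `(1,1)`), the weights `r₁ = 1`, `r₂ = -1`
make the binary summand `⟨m₁, m₂⟩` POSITIVE DEFINITE for every `m₁, m₂ > 0`, the sum has signature
`(3,1)`, and no `K`-plane is totally isotropic (kernel vector of "second `V`-coordinate", then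
`Nm(x₁) + m₁Nm(x₃) + m₂Nm(x₄) = 0`). So the sign condition is load-bearing too. [folklore] -/
theorem aiming_false_without_sign :
    ¬ (∀ (V : Type) [AddCommGroup V] [Module ℚ V] [Module K V] [IsScalarTower ℚ K V]
        [Module.Finite K V] (n : ℕ), Module.finrank K V = 2 * n →
      ∀ (E : LinearMap.BilinForm ℚ V), (∀ x y : V, E x y = -E y x) →
        (∀ x y : V, E (α • x) (α • y) = 11 * E x y) →
        (∃ P N : Submodule K V, Module.finrank K P = n ∧ Module.finrank K N = n ∧ P ⊓ N = ⊥ ∧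
          (∀ x ∈ P, x ≠ 0 → 0 < E x (α • x)) ∧ (∀ x ∈ N, x ≠ 0 → E x (α • x) < 0)) →
      ∀ r₁ r₂ : ℚ,
        ∃ m₁ m₂ : ℕ, 0 < m₁ ∧ 0 < m₂ ∧
          ∃ L : Submodule K (V × (Fin 2 → K)), Module.finrank K L = n + 1 ∧
            ∀ x ∈ L, ∀ y ∈ L,
              bilinOrthSum E
                (diagWeilForm (d := 11) (by norm_num) hα hK (Pi.basisFun K (Fin 2))
                  ![(m₁ : ℚ) * r₁, -((m₂ : ℚ) * r₂)]) x y = 0) := by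
  intro h
  have hE1 : ∀ x y : Fin 2 → K, diagWeilForm eleven_pos hα hK (Pi.basisFun K (Fin 2)) ![1, -1] x y =
      -diagWeilForm eleven_pos hα hK (Pi.basisFun K (Fin 2)) ![1, -1] y x :=
    fun x y => by rw [diagWeilForm_swap _ _ _ _ _ y x]
  have hE2 : ∀ x y : Fin 2 → K,
      diagWeilForm eleven_pos hα hK (Pi.basisFun K (Fin 2)) ![1, -1] (α • x) (α • y) =
        11 * diagWeilForm eleven_pos hα hK (Pi.basisFun K (Fin 2)) ![1, -1] x y :=
    fun x y => diagWeilForm_smul_smul _ _ _ _ _ x y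
  obtain ⟨m₁, m₂, hm₁, hm₂, L, hL, hiso⟩ :=
    h (Fin 2 → K) 1 (by simp) _ hE1 hE2 (signature_one_one hα hK) 1 (-1)
  -- a non-zero vector of `L` with vanishing second (negative) `V`-coordinate
  let f : L →ₗ[K] K :=
    ((LinearMap.proj 1 : (Fin 2 → K) →ₗ[K] K).comp (LinearMap.fst K (Fin 2 → K) (Fin 2 → K))).comp
      L.subtype
  have hker : LinearMap.ker f ≠ ⊥ :=
    LinearMap.ker_ne_bot_of_finrank_lt (by rw [hL, Module.finrank_self]; norm_num)
  obtain ⟨x, hx, hx0⟩ := Submodule.exists_mem_ne_zero_of_ne_bot hker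
  have hx2 : (x : (Fin 2 → K) × (Fin 2 → K)).1 1 = 0 := by
    simpa [f] using hx
  have h0 := hiso x x.2 (α • (x : (Fin 2 → K) × (Fin 2 → K))) (L.smul_mem α x.2)
  rw [bilinOrthSum_apply, Prod.smul_fst, Prod.smul_snd, diagWeilForm_self_alpha,
    diagWeilForm_self_alpha] at h0
  simp only [Matrix.cons_val_zero, Matrix.cons_val_one, one_mul, mul_one, mul_neg, neg_neg] at h0
  have hx2' : nm hα hK ((x : (Fin 2 → K) × (Fin 2 → K)).1 1) = 0 := by
    rw [hx2]; unfold nm; simp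
  rw [hx2'] at h0
  have h1 := nm_nonneg hα hK ((x : (Fin 2 → K) × (Fin 2 → K)).1 0)
  have h3 := nm_nonneg hα hK ((x : (Fin 2 → K) × (Fin 2 → K)).2 0)
  have h4 := nm_nonneg hα hK ((x : (Fin 2 → K) × (Fin 2 → K)).2 1)
  have hm₁' : (0 : ℚ) < m₁ := by exact_mod_cast hm₁
  have hm₂' : (0 : ℚ) < m₂ := by exact_mod_cast hm₂
  have e1 : nm hα hK ((x : (Fin 2 → K) × (Fin 2 → K)).1 0) = 0 := by
    nlinarith [mul_nonneg hm₁'.le h3, mul_nonneg hm₂'.le h4]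
  have e3 : nm hα hK ((x : (Fin 2 → K) × (Fin 2 → K)).2 0) = 0 := by
    have : (m₁ : ℚ) * nm hα hK ((x : (Fin 2 → K) × (Fin 2 → K)).2 0) = 0 := by
      nlinarith [mul_nonneg hm₁'.le h3, mul_nonneg hm₂'.le h4]
    exact (mul_eq_zero.1 this).resolve_left hm₁'.ne'
  have e4 : nm hα hK ((x : (Fin 2 → K) × (Fin 2 → K)).2 1) = 0 := by
    have : (m₂ : ℚ) * nm hα hK ((x : (Fin 2 → K) × (Fin 2 → K)).2 1) = 0 := by
      nlinarith [mul_nonneg hm₁'.le h3, mul_nonneg hm₂'.le h4]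
    exact (mul_eq_zero.1 this).resolve_left hm₂'.ne'
  apply hx0
  have hx' : (x : (Fin 2 → K) × (Fin 2 → K)) = 0 := by
    refine Prod.ext (funext fun i => ?_) (funext fun i => ?_)
    · fin_cases i
      · exact eq_zero_of_nm_eq_zero hα hK e1
      · exact hx2
    · fin_cases i
      · exact eq_zero_of_nm_eq_zero hα hK e3
      · exact eq_zero_of_nm_eq_zero hα hK e4
  exact (Submodule.coe_eq_zero (x := x)).1 hx'

end AimingTightness


/-! ## §J (cycle 3) The card's Chern-character bookkeeping, re-derived IN THE KERNEL (`decide +kernel`)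

Conventions of the card `generic-ppav-secant-descent` ("Why it bites here" (1)): on a ppav `n`-fold work in
`K[y]/(y^{n+1})`, `K = ℚ(√-d)`, `y = 1 - e^{-Θ}` (so `e^{Θ} = (1 - y)⁻¹`), `[O_{Θ_{t₁} ∩ ⋯ ∩ Θ_{t_k}}] = yᵏ` for
generic translates (Koszul; Tor-independence gives `[I_{Z ∪ Z'}] = [I_Z]·[I_{Z'}]`), `α + √-d β = e^{√-d Θ}`.
Rank 2, twist 1: `ch F = ch I_Z(Θ) + ch O(Θ) = 2α + 2β` ⟺ `∏_d (1 - yᵈ)^{m_d} = (2α + 2β)(1 - y) - 1`.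
Rank 1, twist `a`: `e^{aΘ} ∏_d (1 - yᵈ)^{m_d} = α + aβ` ⟺ `∏ = (α + aβ)(1 - y)^{a}`.
Elements of `K` are pairs `(re, im)`; all final coefficients are rational. -/

/-- Elements of `K = ℚ(s)`, `s² = -d`, as pairs `(re, im)`. [folklore] -/
abbrev KQ := ℚ × ℚ

/-- Multiplication in `ℚ(s)`, `s² = -d`. [folklore] -/
def kmulD (d : ℚ) (a b : KQ) : KQ := (a.1 * b.1 - d * a.2 * b.2, a.1 * b.2 + a.2 * b.1)

/-- The coefficients `c_k ∈ K` of `(1 - y)^{-s} = e^{sΘ} = Σ_k c_k yᵏ`: `c₀ = 1`, `c_k = c_{k-1}(s + k - 1)/k`.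
So `α_k = (c_k).1`, `β_k = (c_k).2`. [folklore] -/
def cpowD (d : ℚ) : ℕ → KQ
  | 0 => (1, 0)
  | k + 1 => let c := kmulD d (cpowD d k) ((k : ℚ), 1); (c.1 / (k + 1 : ℚ), c.2 / (k + 1 : ℚ))

/-- Coefficient of `uʲ` in `(1 - u)^m`, `m ∈ ℚ` (generalised binomial; `m ∈ ℕ` for honest strata,
`m = a ∈ ℤ` for the twist `(1 - y)^a = e^{-aΘ}`). [folklore] -/
def oneSubCoeff (m : ℚ) : ℕ → ℚ
  | 0 => 1
  | j + 1 => oneSubCoeff m j * ((j : ℚ) - m) / (j + 1)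

/-- Coefficient of `yⁿ` in `(1 - yᵈ)^m`. [folklore] -/
def strata (d : ℕ) (m : ℚ) (n : ℕ) : ℚ := if d ∣ n then oneSubCoeff m (n / d) else 0

/-- Truncated Cauchy product of coefficient sequences. [folklore] -/
def conv (f g : ℕ → ℚ) (n : ℕ) : ℚ := ((List.range (n + 1)).map fun i => f i * g (n - i)).sum

/-- Rank-2 target (d = 11, twist 1): coefficient of `yᵏ` in `(2α + 2β)(1 - y) - 1`. [folklore] -/
def target2 (k : ℕ) : ℚ :=
  conv (fun i => 2 * ((cpowD 11 i).1 + (cpowD 11 i).2)) (strata 1 1) k - (if k = 0 then 1 else 0)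

/-- Rank-1 target for `K = ℚ(√-d)` and twist `a`: coefficient of `yᵏ` in `(α + aβ)(1 - y)^a`. [folklore] -/
def target1 (d a : ℚ) (k : ℕ) : ℚ :=
  conv (fun i => (cpowD d i).1 + a * (cpowD d i).2) (strata 1 a) k

/-- The card's rank-2 configuration on the ppav SIXFOLD: `∏_{d=2}^{6} (1 - yᵈ)^{m_d}`,
`(m₂, …, m₆) = (12, 4, 57, 36, 462)`. [folklore] -/
def config6 (n : ℕ) : ℚ :=
  conv (conv (conv (conv (strata 2 12) (strata 3 4)) (strata 4 57)) (strata 5 36)) (strata 6 462) n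

/-- The same configuration on the ppav FIVEFOLD (no `Θ⁶` stratum): `(m₂, …, m₅) = (12, 4, 57, 36)`. [folklore] -/
def config5 (n : ℕ) : ℚ := conv (conv (conv (strata 2 12) (strata 3 4)) (strata 4 57)) (strata 5 36) n

/-- **n = 6, rank 2, d = 11 (the bet's configuration), kernel-checked**: `12` fourfolds `Θ∩Θ'`, `4` threefolds
`Θ³`, `57` surfaces `Θ⁴`, `36` curves `Θ⁵`, `462` point strata `Θ⁶` solve `e^{Θ}∏ + e^{Θ} = 2α + 2β` in
`K[y]/(y⁷)`. [folklore] -/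
theorem secantConfiguration_n6 : ∀ k < 7, config6 k = target2 k := by decide +kernel

/-- **n = 5**: the truncation `(12, 4, 57, 36)` solves the same equation in `K[y]/(y⁶)` (the `n = 6` solution
extends the `n = 5` one). [folklore] -/
theorem secantConfiguration_n5 : ∀ k < 6, config5 k = target2 k := by decide +kernel

/-- Degree 7: the five strata contribute `396` to the `y⁷` coefficient … [folklore] -/
theorem config6_seven : config6 7 = 396 := by decide +kernel

/-- … the target's `y⁷` coefficient is `18/7` … [folklore] -/
theorem target2_seven : target2 7 = 18 / 7 := by decide +kernel

/-- … and a sixth stratum `(1 - y⁷)^{m₇}` shifts the `y⁷` coefficient by exactly `-m₇` (and nothing below), so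
`m₇ = 396 - 18/7 = 2754/7 ∉ ℤ`: **the configuration does NOT extend integrally to a ppav sevenfold** — the
card's "window `n ≤ 6`" (`strata_seven_shift` + `no_integral_m7`). [folklore] -/
theorem strata_seven_shift (m : ℚ) : (∀ k < 7, strata 7 m k = if k = 0 then 1 else 0) ∧ strata 7 m 7 = -m := by
  refine ⟨?_, ?_⟩
  · intro k hk
    interval_cases k <;> simp [strata, oneSubCoeff]
  · simp [strata, oneSubCoeff]

/-- No integer `m₇` repairs degree 7. [folklore] -/
theorem no_integral_m7 : ∀ m : ℤ, (396 : ℚ) - m ≠ 18 / 7 := by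
  intro m h
  have h7 : (7 : ℚ) * m = 2754 := by linarith
  have h7' : (7 : ℤ) * m = 2754 := by exact_mod_cast h7
  omega

/-- **Rank 1, d = 11, twist a = 1 is obstructed by PARITY at n = 4** (card (i)): `(m₂, m₃) = (6, 2)` is forced
in degrees `≤ 3` (`6` curves `Θ∩Θ'` + `2` point strata on a threefold — Markman's K-class at `n = 3`), and then
degree 4 needs `m₄ = 15 - 9/2 = 21/2 ∉ ℤ`. [folklore] -/
theorem rankOne_d11_a1 :
    (∀ k < 4, conv (strata 2 6) (strata 3 2) k = target1 11 1 k) ∧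
      conv (strata 2 6) (strata 3 2) 4 = 15 ∧ target1 11 1 4 = 9 / 2 ∧ ∀ m : ℤ, (15 : ℚ) - m ≠ 9 / 2 := by
  refine ⟨by decide +kernel, by decide +kernel, by decide +kernel, ?_⟩
  intro m h
  have h2 : (2 : ℚ) * m = 21 := by linarith
  have h2' : (2 : ℤ) * m = 21 := by exact_mod_cast h2
  omega

/-- **Rank 1, d = 44 (= 4·11, same field), twist a = -18, n = 5 is INTEGRAL** (card (ii)):
`(m₂, …, m₅) = (184, 2392, 34546, 534428)`. [folklore] -/
theorem rankOne_d44_a_neg18_n5 :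
    ∀ k < 6, conv (conv (conv (strata 2 184) (strata 3 2392)) (strata 4 34546)) (strata 5 534428) k =
      target1 44 (-18) k := by
  decide +kernel

/-! ## §E Near-misses (documented `sorry`; NOT claims) -/

/-- NEAR-MISS (mathematically a theorem, formally out of reach — F2). `WithoutHodgeType` is FALSE.
Witness: `E = ℂ/ℤ[(1+√-11)/2]` (class number one, so `End E = O_K ∋ √-11`), `A = E¹⁰`, `φ = diag(√-11)`, so
`φ ≫ φ = -11` and `dim A = 10`. On `H¹(A, ℂ) = V₊ ⊕ V₋` the CM type puts `V₊ = H^{1,0}(A)` (signature `(10, 0)`),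
hence `∧¹⁰V₊ = H^{10,0}`, `∧¹⁰V₋ = H^{0,10}` and `weilPlane A φ = H^{10,0} ⊕ H^{0,10}`. It contains the
2-dimensional `ℚ`-space `W_K = ∧¹⁰_K H¹(A, ℚ)` of rational classes; a nonzero `c ∈ W_K` has a nonzero
`(0,10)`-component, while `algebraicClasses A.X 5 ⊆ F⁵H¹⁰` (classes supported on codimension-5 subvarieties;
Deligne, Hodge II, Cor. 8.2.8) — so `c ∉ algebraicClasses A.X 5`. OBSTRUCTION: no CM elliptic curve, no product
`E¹⁰` as `AbelianVariety ℂ`, no `H^*(A(ℂ)) = ∧^*H¹`, no Hodge-theoretic bound `N⁵ ⊆ F⁵` in the tree. Tried: the zero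
abelian variety (dim 0), Weierstrass models (no `√-11`). [cite: vanGeemen1994HodgeAV, 4.9–4.10] -/
theorem withoutHodgeType_false : ¬ WithoutHodgeType := by
  sorry

/-- NEAR-MISS (mathematically a theorem, formally out of reach). `WithoutRat ↔ crux`: `←` because
`algebraicClasses A.X 5` is a `ℂ`-submodule and every `(5,5)`-class of `weilPlane A φ` is a `ℂ`-combination of
rational `(5,5)`-classes of the plane (the plane is `W_K ⊗_ℚ ℂ` with `W_K ⊆ H¹⁰(A, ℚ)`; on Weil type all of it is
`(5,5)`, otherwise its `(5,5)`-part vanishes). OBSTRUCTION: needs `H¹⁰(A(ℂ); ℂ) = H¹⁰(A(ℂ); ℚ) ⊗ ℂ` compatibly with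
`(𝟙+φ)^*` and the Hodge decomposition of a HodgeModel — none in tree. [cite: vanGeemen1994HodgeAV, 4.9] -/
theorem withoutRat_iff :
    WithoutRat ↔ Summit.HodgeConjecture.HodgeConjecture.Theses.HeckePrymWeil.WeilTenfoldsSqrtMinus11 := by
  refine ⟨fun hW A φ hdim hφ c _ hhodge hweil => hW A φ hdim hφ c hhodge hweil, fun h => ?_⟩
  sorry

/-- NEAR-MISS (TRUE statement, paper witness; documents that the typed purity stub is TOOTHLESS for large `r`):
`GaussPeriodDesign 33`. Witness scheme: all `n_t = 0` (every condition with `k ≥ 1` becomes `0 = 0` since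
`0ᵏ = 0`), `λ_t ∈ K = ℚ(√-11) ⊂ ℚ(ζ₁₁)` (then `∏_{a∈S} σ_a(λ) = λ^{|S∩□|} λ̄^{|S∩⊠|}`, so the 1020 sets `S`
impose only the 32 conditions `Σ_t s_t λ_t^i λ̄_t^j = 0`, `(i,j) ∈ [0,5]² ∖ {(0,0),(5,0),(0,5),(5,5)}` —
32 independent ℚ-linear forms in `s` after the conjugation symmetry — while `Σ_t s_t λ_t⁵ ≠ 0` is an
independent monomial condition); 33 points of `K` in general position and integer weights spanning the
kernel do it. OBSTRUCTION: the Galois bookkeeping `σ_a|_K = id (a ∈ □) / conj (a ∈ ⊠)` on `embed` and a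
33-point certificate are far beyond a cheap check; the statement carries no Mukai-index / Ext¹-connectivity
information, which is the card's actual open core (triage r1-1/2/3 concur). [folklore] -/
theorem gaussPeriodDesign_large : GaussPeriodDesign 33 := by
  sorry

end Summit.HodgeConjecture.HodgeConjecture.Cruxes.WeilTenfoldsSqrtMinus11.Disproof

end
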